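import Literature.Geometry.Lorentzian.KerrDeSitterHeunForm
import HarnessLib

/-!
# The Kerr–de Sitter radial Teukolsky equation IS Heun's equation: the solution-level equivalence
# and the horizon conditions in the `z` variable (Hatsuda 2020 (2.15)–(2.21), §2.3, §3.1 =
# Suzuki–Takasugi–Umetsu 1998 (3.8)–(3.10)); mode solutions = Hatsuda's connection problem

Source read verbatim: Y. Hatsuda, *Quasinormal modes of Kerr–de Sitter black holes via the Heun
function*, Class. Quantum Grav. 38 (2020) 025015 = arXiv:2006.08957 [Hatsuda2020], §2.2: "We further
perform the following transformation: `z = (r₊'−r₋)(r−r₊)/((r₊'−r₊)(r−r₋))` (2.15) … and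
`R(z) = z^{B₁}(z−1)^{B₂}(z−z_r)^{B₃}(z−z_∞)^{2s+1} y(z)` (2.17), `B_j := i(1+α)K(r_j)/Δ_r'(r_j)`
(2.18). Then, the radial Teukolsky equation (2.13) is transformed into Heun's equation:
`y'' + (γ/z + δ/(z−1) + ε/(z−z_r)) y' + (σ₊σ₋ z + v)/(z(z−1)(z−z_r)) y = 0` (2.19)" with the data
(2.20)–(2.21); H. Suzuki, E. Takasugi, H. Umetsu, Prog. Theor. Phys. 100 (1998) 491 =
arXiv:gr-qc/9805064 [SuzukiTakasugiUmetsu1998], §3.2 (3.7)–(3.10) (the same reduction).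

The companion file `KerrDeSitterHeunForm.lean` proves the three COEFFICIENT identities behind this
sentence (`heun_lead_identity`, `heun_mid_identity`, `heun_low_identity`) and left the assembled,
solution-level statement as a `TODO(general form)`. This file discharges it (0 facts; everything is
a definition with a body or a theorem):

* `mobiusInv` — the inverse Möbius map `r(z) = r₋ + z_∞(r₊−r₋)/(z_∞−z)` with `mobiusZ_mobiusInv`,
  `mobiusInv_mobiusZ`, `mobiusInv_zero = r₊`, `mobiusInv_one = r_c`, `mobiusInv_mem_Ioo`
  (`(0,1) → (r₊, r_c)`), `mobiusZ_mem_Ioo` (`(r₊, r_c) → (0,1)`), its derivatives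
  `hasDerivAt_mobiusInv`, `hasDerivAt_mobiusInvDeriv`, `contDiffOn_mobiusInv` (and
  `contDiffOn_mobiusZ`) and the inverse-function relations
  `mobiusZDeriv_mul_mobiusInvDeriv` (`z'(r(z)) r'(z) = 1`), `mobiusInvDeriv2_eq`
  (`r'' = −z''·r'³`); `one_lt_mobiusZinf`, `one_lt_mobiusZr` (no singular point of the Heun
  equation inside `(0, 1)`: Hatsuda's `z_r`, `z_∞` lie beyond `1` on subextremal parameters).
* `heunWeight` — Hatsuda's s-homotopic weight written in the `r` variable with positive real bases,
  `w(r) = (r−r₊)^{B₁}(r_c−r)^{B₂}(r−r₋')^{B₃}(r−r₋)^{B(r₋)−2s−1}`: since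
  `z = z_∞(r−r₊)/(r−r₋)`, `1−z = (r₊−r₋)(r_c−r)/((r_c−r₊)(r−r₋))`, `z_r−z ∝ (r−r₋')/(r−r₋)`,
  `z_∞−z = z_∞(r₊−r₋)/(r−r₋)` and `B₁+B₂+B₃ = −B(r₋)` (`horizonB_sum`), this is (2.17)'s
  `z^{B₁}(z−1)^{B₂}(z−z_r)^{B₃}(z−z_∞)^{2s+1}` up to a constant non-zero factor (constant phases,
  constant positive factors raised to the exponents), which is immaterial for a linear homogeneous
  equation; `hasDerivAt_heunWeight`: `w' = w·L` with `L = heunL` (by `heunL_eq_sum`);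
  `heunWeight_ne_zero`.
* `weightedEquation_of_isRadialTeukolskySolution` — for a classical radial solution `R`
  (`IsRadialTeukolskySolution`, STU (3.7) = Hatsuda (2.13)), `Y = R/w` satisfies the conjugated
  `r`-equation `Δ_r Y'' + (2Δ_r L + (s+1)Δ_r')Y' + (Δ_r(L²+L') + (s+1)Δ_r'L + V)Y = 0`.
* `heunSolution_of_isRadialTeukolskySolution` — **(2.13) ⇒ (2.19)**: `y = (R/w) ∘ r(·)` is a
  classical solution on `(0, 1)` of Heun's equation with Hatsuda's data
  `(a_H = z_r; α = σ₊, β = σ₋; γ, δ, ε; q = v)` in Umetsu's normalisation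
  (`GeneralHeun.IsSolutionOn` of `HeunDerivative.lean`), by the chain rule and the three identities.
* `isRadialTeukolskySolution_of_heunSolution` — **(2.19) ⇒ (2.13)**: for a classical Heun
  solution `y` on `(0, 1)`, `R = w · (y ∘ z)` is a classical radial solution on `(r₊, r_c)`.
* `isRadialTeukolskySolution_iff_heunSolution` — the equivalence for a given `R`.
* The horizon boundary conditions in the `z` variable (Hatsuda §2.3 (2.24)–(2.25): the local Heun
  solutions at `z = 0` are `y₀₁ = Hl(…; z)` (exponent `0`) and `y₀₂ = z^{1−γ}Hl(…; z)` (exponent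
  `1−γ`), at `z = 1` `y₁₁ = Hl(…; 1−z)` (exponent `0`) and `y₁₂ = (1−z)^{1−δ}Hl(…; 1−z)`; §3.1
  (3.3)–(3.5): "`R₀₂` satisfies the QNM boundary condition at the event horizon … `R₁₁` is a
  preferred solution. The QNM boundary condition then requires `C₂₂ = 0`"), as `Prop`s with bodies:
  `IsHeunBranchAtZero` (`y = z^{1−γ}·G` on a right neighbourhood of `0`, `G` `C^∞` across `0`),
  `IsHeunRegularAtOne` (`y` agrees left of `1` with a function `C^∞` across `1`),
  `HasHeunConnectionSolution` (a classical Heun solution `y ≢ 0` on `(0, 1)` with both), and the four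
  translations: `heunSolution_branch_at_zero` (`IsIngoingAtEventHorizon R`, i.e. the tree's
  transcription of CTdC Def. 3.3 / Hatsuda §3.1 "`R(r)(r−r₊)^{s+B₁}` smooth at `r₊`", gives
  `IsHeunBranchAtZero` for `y = (R/w) ∘ r(·)`), `heunSolution_smooth_at_one`
  (`IsOutgoingAtCosmoHorizon R` gives `IsHeunRegularAtOne`), and conversely
  `isIngoingAtEventHorizon_of_heun_branch_at_zero`, `isOutgoingAtCosmoHorizon_of_heun_smooth_at_one`
  for `R = w·(y ∘ z)` (bookkeeping of principal powers of positive reals: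
  `b^{s+B₁}·b^{B₁}·b^{1−γ} = b⁰ = 1` for `b = r − r₊`, `z = (r−r₊)·z_∞/(r−r₋)`, continuity of the two
  Möbius maps at the endpoints).
* `hasMode_iff_heunConnection`: **`HasMode M a Λ s ω m ↔ ∃ λ, IsAngularEigenvalue … λ ∧
  HasHeunConnectionSolution M a Λ s ω m λ`** (with `hasHeunConnectionSolution_of_isModeSolution`,
  `isModeSolution_of_hasHeunConnectionSolution`), and `noModeIn_iff_heunConnection`: the tree's
  "no mode in the window `W`" (`NoModeIn`, the statement the pub-kds certificates establish box by
  box) is literally the absence of non-trivial solutions of Hatsuda's connection problem — the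
  statement a Heun-function computation (`C₂₂(ω) ≠ 0`) addresses.

Honest framing: change of variables and boundary bookkeeping only; nothing in this file is a
statement about the spectrum (no mode is excluded or produced here). As in
`KerrDeSitterTeukolskyRadial.lean`, only the GENERIC bullets of CTdC Def. 3.3 are rendered by
`IsIngoingAtEventHorizon`/`IsOutgoingAtCosmoHorizon`, and hence by their Heun-side images.

## References
* Y. Hatsuda, Class. Quantum Grav. 38 (2020) 025015, arXiv:2006.08957, §2.2 (2.13)–(2.22), §2.3
  (2.24)–(2.26), §3.1 (3.2)–(3.5) (equation numbers of the arXiv version). [Hatsuda2020]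
* H. Suzuki, E. Takasugi, H. Umetsu, Prog. Theor. Phys. 100 (1998) 491–505, §3.2 (3.7)–(3.10).
  [SuzukiTakasugiUmetsu1998]
-/

noncomputable section

open Complex Set

namespace Literature.Geometry.Lorentzian.KerrDeSitter

open Literature.Analysis.ODE

/-- Elementary positions for `r ∈ (r₊, r_c)` on subextremal parameters (all the differences that
appear as bases or denominators are non-zero / positive). [folklore] -/
private theorem interval_facts {M a Λ : ℝ} (hsub : IsSubextremal M a Λ) {r : ℝ}
    (hr : r ∈ Ioo (rPlus M a Λ) (rCosmo M a Λ)) :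
    0 < Λ ∧ rMinus M a Λ < rPlus M a Λ ∧ rPlus M a Λ < rCosmo M a Λ ∧ rNeg M a Λ < rMinus M a Λ ∧
      rPlus M a Λ < r ∧ r < rCosmo M a Λ ∧ 0 < delta M a Λ r := by
  have h0 := rMinus_nonneg M a Λ
  obtain ⟨hM, hΛ, h01, h12, -, -, -, hpos, -⟩ := hsub
  refine ⟨hΛ, h01, h12, ?_, hr.1, hr.2, hpos r hr⟩
  simp only [rNeg]
  linarith

/-! ### The inverse Möbius map; `r ∈ (r₊, r_c)` corresponds to `z ∈ (0, 1)` -/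

/-- The inverse of Hatsuda's Möbius map: solving `z = z_∞(r − r₊)/(r − r₋)` for `r`,
`r(z) = r₋ + z_∞(r₊ − r₋)/(z_∞ − z)` (`0 ↦ r₊`, `1 ↦ r₊' = r_c`, `z_∞ ↦ ∞`).
[cite: Hatsuda2020, (2.15)–(2.16)] -/
def mobiusInv (M a Λ x : ℝ) : ℝ :=
  rMinus M a Λ + mobiusZinf M a Λ * (rPlus M a Λ - rMinus M a Λ) / (mobiusZinf M a Λ - x)

/-- `dr/dz = z_∞(r₊ − r₋)/(z_∞ − z)²`. [cite: Hatsuda2020, (2.15)–(2.16)] -/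
def mobiusInvDeriv (M a Λ x : ℝ) : ℝ :=
  mobiusZinf M a Λ * (rPlus M a Λ - rMinus M a Λ) / (mobiusZinf M a Λ - x) ^ 2

/-- `d²r/dz² = 2z_∞(r₊ − r₋)/(z_∞ − z)³`. [cite: Hatsuda2020, (2.15)–(2.16)] -/
def mobiusInvDeriv2 (M a Λ x : ℝ) : ℝ :=
  2 * mobiusZinf M a Λ * (rPlus M a Λ - rMinus M a Λ) / (mobiusZinf M a Λ - x) ^ 3

/-- `z = z_∞ · (r − r₊)/(r − r₋)`. [cite: Hatsuda2020, (2.15)–(2.16)] -/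
theorem mobiusZ_eq_zinf_mul (M a Λ r : ℝ) :
    mobiusZ M a Λ r = mobiusZinf M a Λ * ((r - rPlus M a Λ) / (r - rMinus M a Λ)) := by
  unfold mobiusZ mobiusZinf
  rw [mul_div_mul_comm]

/-- `1 < z_∞` on subextremal parameters (`r₋ < r₊ < r_c`), so `z_∞ ∉ [0, 1]`.
[cite: Hatsuda2020, (2.16)] -/
theorem one_lt_mobiusZinf {M a Λ : ℝ} (hsub : IsSubextremal M a Λ) : 1 < mobiusZinf M a Λ := by
  obtain ⟨-, -, h01, h12, -⟩ := hsub
  unfold mobiusZinf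
  rw [one_lt_div (by linarith)]
  linarith

/-- `z_∞ (r_c − r₊) = r_c − r₋`. [cite: Hatsuda2020, (2.16)] -/
theorem mobiusZinf_mul {M a Λ : ℝ} (hsub : IsSubextremal M a Λ) :
    mobiusZinf M a Λ * (rCosmo M a Λ - rPlus M a Λ) = rCosmo M a Λ - rMinus M a Λ := by
  obtain ⟨-, -, h01, h12, -⟩ := hsub
  have hc : rCosmo M a Λ - rPlus M a Λ ≠ 0 := by linarith
  unfold mobiusZinf
  rw [div_mul_cancel₀ _ hc]

/-- `1 − z = (r₊ − r₋)(r_c − r)/((r_c − r₊)(r − r₋))`. [cite: Hatsuda2020, (2.15)–(2.16)] -/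
theorem one_sub_mobiusZ {M a Λ : ℝ} (hsub : IsSubextremal M a Λ) {r : ℝ} (hr : r ≠ rMinus M a Λ) :
    1 - mobiusZ M a Λ r = (rPlus M a Λ - rMinus M a Λ) * (rCosmo M a Λ - r) /
      ((rCosmo M a Λ - rPlus M a Λ) * (r - rMinus M a Λ)) := by
  obtain ⟨-, -, h01, h12, -⟩ := hsub
  have hx : r - rMinus M a Λ ≠ 0 := sub_ne_zero.2 hr
  have hc : rCosmo M a Λ - rPlus M a Λ ≠ 0 := by linarith
  unfold mobiusZ
  field_simp
  ring

/-- `z_∞ − z = z_∞(r₊ − r₋)/(r − r₋)`. [cite: Hatsuda2020, (2.15)–(2.16)] -/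
theorem mobiusZinf_sub_mobiusZ {M a Λ : ℝ} (hsub : IsSubextremal M a Λ) {r : ℝ}
    (hr : r ≠ rMinus M a Λ) :
    mobiusZinf M a Λ - mobiusZ M a Λ r =
      mobiusZinf M a Λ * (rPlus M a Λ - rMinus M a Λ) / (r - rMinus M a Λ) := by
  obtain ⟨-, -, h01, h12, -⟩ := hsub
  have hx : r - rMinus M a Λ ≠ 0 := sub_ne_zero.2 hr
  have hc : rCosmo M a Λ - rPlus M a Λ ≠ 0 := by linarith
  unfold mobiusZ mobiusZinf
  field_simp
  ring

/-- `1 < z_r` on subextremal parameters (`r₋' < 0 ≤ r₋ < r₊`): together with `1 < z_∞`, no singular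
point of the Heun equation lies inside `(0, 1)`. [cite: Hatsuda2020, (2.16)] -/
theorem one_lt_mobiusZr {M a Λ : ℝ} (hsub : IsSubextremal M a Λ) : 1 < mobiusZr M a Λ := by
  have h0 := rMinus_nonneg M a Λ
  have h := hsub
  obtain ⟨-, -, h01, h12, -⟩ := hsub
  have hw : rNeg M a Λ = -(rMinus M a Λ + rPlus M a Λ + rCosmo M a Λ) := rfl
  have hne : rNeg M a Λ ≠ rMinus M a Λ := by rw [hw]; intro h'; linarith
  have e := one_sub_mobiusZ h hne
  rw [hw] at e
  have hlt : 1 - mobiusZr M a Λ < 0 := by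
    unfold mobiusZr
    rw [hw, e]
    apply div_neg_of_pos_of_neg
    · nlinarith
    · nlinarith
  linarith

/-- `r ∈ (r₊, r_c) ⇒ z(r) ∈ (0, 1)`. [cite: Hatsuda2020, (2.15)–(2.16)] -/
theorem mobiusZ_mem_Ioo {M a Λ : ℝ} (hsub : IsSubextremal M a Λ) {r : ℝ}
    (hr : r ∈ Ioo (rPlus M a Λ) (rCosmo M a Λ)) : mobiusZ M a Λ r ∈ Ioo (0 : ℝ) 1 := by
  obtain ⟨-, h01, h12, -, hr1, hr2, -⟩ := interval_facts hsub hr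
  have hrm : r ≠ rMinus M a Λ := by intro h; linarith
  have hz1 := one_lt_mobiusZinf hsub
  refine ⟨?_, ?_⟩
  · rw [mobiusZ_eq_zinf_mul]
    exact mul_pos (by linarith) (div_pos (by linarith) (by linarith))
  · have h := one_sub_mobiusZ hsub hrm
    have : 0 < 1 - mobiusZ M a Λ r := by
      rw [h]
      exact div_pos (mul_pos (by linarith) (by linarith)) (mul_pos (by linarith) (by linarith))
    linarith

/-- `r(z) − r₋ = z_∞(r₊ − r₋)/(z_∞ − z)`. [cite: Hatsuda2020, (2.15)–(2.16)] -/
theorem mobiusInv_sub_rMinus (M a Λ x : ℝ) :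
    mobiusInv M a Λ x - rMinus M a Λ =
      mobiusZinf M a Λ * (rPlus M a Λ - rMinus M a Λ) / (mobiusZinf M a Λ - x) := by
  unfold mobiusInv
  ring

/-- `r(z) − r₊ = (r₊ − r₋) z/(z_∞ − z)` (`z ≠ z_∞`). [cite: Hatsuda2020, (2.15)–(2.16)] -/
theorem mobiusInv_sub_rPlus {M a Λ x : ℝ} (hx : x ≠ mobiusZinf M a Λ) :
    mobiusInv M a Λ x - rPlus M a Λ =
      (rPlus M a Λ - rMinus M a Λ) * x / (mobiusZinf M a Λ - x) := by
  have hx' : mobiusZinf M a Λ - x ≠ 0 := sub_ne_zero.2 (Ne.symm hx)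
  unfold mobiusInv
  field_simp
  ring

/-- `r(0) = r₊`. [cite: Hatsuda2020, (2.15)–(2.16)] -/
theorem mobiusInv_zero {M a Λ : ℝ} (hsub : IsSubextremal M a Λ) : mobiusInv M a Λ 0 = rPlus M a Λ := by
  have hz : (0 : ℝ) ≠ mobiusZinf M a Λ := (lt_trans one_pos (one_lt_mobiusZinf hsub)).ne
  have h := mobiusInv_sub_rPlus hz
  rw [mul_zero, zero_div, sub_eq_zero] at h
  exact h

/-- `r(1) = r_c`. [cite: Hatsuda2020, (2.15)–(2.16)] -/
theorem mobiusInv_one {M a Λ : ℝ} (hsub : IsSubextremal M a Λ) : mobiusInv M a Λ 1 = rCosmo M a Λ := by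
  have hz1 := one_lt_mobiusZinf hsub
  have hm := mobiusZinf_mul hsub
  obtain ⟨-, -, h01, h12, -⟩ := hsub
  have hz : mobiusZinf M a Λ - 1 ≠ 0 := by linarith
  have e : mobiusZinf M a Λ - 1 = (rPlus M a Λ - rMinus M a Λ) / (rCosmo M a Λ - rPlus M a Λ) := by
    rw [eq_div_iff (by linarith)]
    linarith
  have hd : rPlus M a Λ - rMinus M a Λ ≠ 0 := by linarith
  have hc : rCosmo M a Λ - rPlus M a Λ ≠ 0 := by linarith
  have h2 : mobiusZinf M a Λ * (rPlus M a Λ - rMinus M a Λ) /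
      ((rPlus M a Λ - rMinus M a Λ) / (rCosmo M a Λ - rPlus M a Λ)) =
      mobiusZinf M a Λ * (rCosmo M a Λ - rPlus M a Λ) := by
    rw [div_div_eq_mul_div, mul_assoc, mul_comm (rPlus M a Λ - rMinus M a Λ), ← mul_assoc,
      mul_div_cancel_right₀ _ hd]
  unfold mobiusInv
  rw [e, h2, hm]
  ring

/-- `z ∈ (0, 1) ⇒ r(z) ∈ (r₊, r_c)` (`r(z) − r₋ = z_∞(r₊−r₋)/(z_∞ − z)` is increasing on `z < z_∞`,
with `r(0) = r₊`, `r(1) = r_c`). [cite: Hatsuda2020, (2.15)–(2.16)] -/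
theorem mobiusInv_mem_Ioo {M a Λ : ℝ} (hsub : IsSubextremal M a Λ) {x : ℝ} (hx : x ∈ Ioo (0 : ℝ) 1) :
    mobiusInv M a Λ x ∈ Ioo (rPlus M a Λ) (rCosmo M a Λ) := by
  have hz1 := one_lt_mobiusZinf hsub
  have h0 := mobiusInv_zero hsub
  have h1 := mobiusInv_one hsub
  obtain ⟨-, -, h01, h12, -⟩ := hsub
  have hC : 0 < mobiusZinf M a Λ * (rPlus M a Λ - rMinus M a Λ) := mul_pos (by linarith) (by linarith)
  rw [← h0, ← h1]
  unfold mobiusInv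
  refine ⟨?_, ?_⟩
  · have : mobiusZinf M a Λ * (rPlus M a Λ - rMinus M a Λ) / (mobiusZinf M a Λ - 0) <
        mobiusZinf M a Λ * (rPlus M a Λ - rMinus M a Λ) / (mobiusZinf M a Λ - x) :=
      div_lt_div_of_pos_left hC (by linarith [hx.2]) (by linarith [hx.1])
    linarith
  · have : mobiusZinf M a Λ * (rPlus M a Λ - rMinus M a Λ) / (mobiusZinf M a Λ - x) <
        mobiusZinf M a Λ * (rPlus M a Λ - rMinus M a Λ) / (mobiusZinf M a Λ - 1) :=
      div_lt_div_of_pos_left hC (by linarith [hx.2]) (by linarith [hx.2])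
    linarith

/-- `r(z(r)) = r` for `r ≠ r₋`. [cite: Hatsuda2020, (2.15)–(2.16)] -/
theorem mobiusInv_mobiusZ {M a Λ : ℝ} (hsub : IsSubextremal M a Λ) {r : ℝ} (hr : r ≠ rMinus M a Λ) :
    mobiusInv M a Λ (mobiusZ M a Λ r) = r := by
  have hz1 := one_lt_mobiusZinf hsub
  have e := mobiusZinf_sub_mobiusZ hsub hr
  obtain ⟨-, -, h01, h12, -⟩ := hsub
  have hx : r - rMinus M a Λ ≠ 0 := sub_ne_zero.2 hr
  have hz0 : mobiusZinf M a Λ ≠ 0 := by linarith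
  have hd : rPlus M a Λ - rMinus M a Λ ≠ 0 := by linarith
  unfold mobiusInv
  rw [e]
  field_simp
  ring

/-- `z(r(z)) = z` for `z ≠ z_∞`. [cite: Hatsuda2020, (2.15)–(2.16)] -/
theorem mobiusZ_mobiusInv {M a Λ : ℝ} (hsub : IsSubextremal M a Λ) {x : ℝ} (hx : x ≠ mobiusZinf M a Λ) :
    mobiusZ M a Λ (mobiusInv M a Λ x) = x := by
  have hz1 := one_lt_mobiusZinf hsub
  obtain ⟨-, -, h01, h12, -⟩ := hsub
  have hx' : mobiusZinf M a Λ - x ≠ 0 := sub_ne_zero.2 (Ne.symm hx)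
  have hz0 : mobiusZinf M a Λ ≠ 0 := by linarith
  have hd : rPlus M a Λ - rMinus M a Λ ≠ 0 := by linarith
  rw [mobiusZ_eq_zinf_mul, mobiusInv_sub_rPlus hx, mobiusInv_sub_rMinus]
  field_simp

/-- `dr/dz` is the derivative of the inverse Möbius map (`z ≠ z_∞`). [cite: Hatsuda2020, (2.15)] -/
theorem hasDerivAt_mobiusInv (M a Λ : ℝ) {x : ℝ} (hx : x ≠ mobiusZinf M a Λ) :
    HasDerivAt (mobiusInv M a Λ) (mobiusInvDeriv M a Λ x) x := by
  have hx' : mobiusZinf M a Λ - x ≠ 0 := sub_ne_zero.2 (Ne.symm hx)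
  have h := ((((hasDerivAt_id x).const_sub (mobiusZinf M a Λ)).inv hx').const_mul
    (mobiusZinf M a Λ * (rPlus M a Λ - rMinus M a Λ))).const_add (rMinus M a Λ)
  have e : mobiusInv M a Λ = fun t => rMinus M a Λ +
      mobiusZinf M a Λ * (rPlus M a Λ - rMinus M a Λ) * (mobiusZinf M a Λ - id t)⁻¹ := by
    funext t; simp only [mobiusInv, id, div_eq_mul_inv]
  rw [e]
  refine h.congr_deriv ?_
  unfold mobiusInvDeriv
  simp only [id]
  field_simp

/-- `d²r/dz²` is the derivative of `dr/dz` (`z ≠ z_∞`). [cite: Hatsuda2020, (2.15)] -/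
theorem hasDerivAt_mobiusInvDeriv (M a Λ : ℝ) {x : ℝ} (hx : x ≠ mobiusZinf M a Λ) :
    HasDerivAt (mobiusInvDeriv M a Λ) (mobiusInvDeriv2 M a Λ x) x := by
  have hx' : mobiusZinf M a Λ - x ≠ 0 := sub_ne_zero.2 (Ne.symm hx)
  have h2 : HasDerivAt (fun t : ℝ => (mobiusZinf M a Λ - t) ^ 2)
      (((2 : ℕ) : ℝ) * (mobiusZinf M a Λ - x) ^ (2 - 1) * -1) x :=
    ((hasDerivAt_id x).const_sub (mobiusZinf M a Λ)).pow 2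
  have h := (h2.inv (pow_ne_zero 2 hx')).const_mul (mobiusZinf M a Λ * (rPlus M a Λ - rMinus M a Λ))
  have e : mobiusInvDeriv M a Λ = fun t =>
      mobiusZinf M a Λ * (rPlus M a Λ - rMinus M a Λ) * ((mobiusZinf M a Λ - t) ^ 2)⁻¹ := by
    funext t; simp only [mobiusInvDeriv, div_eq_mul_inv]
  rw [e]
  refine h.congr_deriv ?_
  unfold mobiusInvDeriv2
  field_simp
  ring

/-- `z'(r(z)) · r'(z) = 1` (`z ≠ z_∞`; both maps are Möbius). [cite: Hatsuda2020, (2.15)] -/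
theorem mobiusZDeriv_mul_mobiusInvDeriv {M a Λ : ℝ} (hsub : IsSubextremal M a Λ) {x : ℝ}
    (hx : x ≠ mobiusZinf M a Λ) :
    mobiusZDeriv M a Λ (mobiusInv M a Λ x) * mobiusInvDeriv M a Λ x = 1 := by
  have hz1 := one_lt_mobiusZinf hsub
  have hm := mobiusZinf_mul hsub
  obtain ⟨-, -, h01, h12, -⟩ := hsub
  have hx' : mobiusZinf M a Λ - x ≠ 0 := sub_ne_zero.2 (Ne.symm hx)
  have hz0 : mobiusZinf M a Λ ≠ 0 := by linarith
  have hd : rPlus M a Λ - rMinus M a Λ ≠ 0 := by linarith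
  have hc : rCosmo M a Λ - rPlus M a Λ ≠ 0 := by linarith
  unfold mobiusZDeriv mobiusInvDeriv
  rw [mobiusInv_sub_rMinus, ← hm]
  field_simp

/-- `r''(z) = −z''(r(z)) · r'(z)³` (differentiating `z'(r(z)) r'(z) = 1`). [cite: Hatsuda2020, (2.15)] -/
theorem mobiusInvDeriv2_eq {M a Λ : ℝ} (hsub : IsSubextremal M a Λ) {x : ℝ}
    (hx : x ≠ mobiusZinf M a Λ) :
    mobiusInvDeriv2 M a Λ x = -mobiusZDeriv2 M a Λ (mobiusInv M a Λ x) * mobiusInvDeriv M a Λ x ^ 3 := by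
  have hz1 := one_lt_mobiusZinf hsub
  have hm := mobiusZinf_mul hsub
  obtain ⟨-, -, h01, h12, -⟩ := hsub
  have hx' : mobiusZinf M a Λ - x ≠ 0 := sub_ne_zero.2 (Ne.symm hx)
  have hz0 : mobiusZinf M a Λ ≠ 0 := by linarith
  have hd : rPlus M a Λ - rMinus M a Λ ≠ 0 := by linarith
  have hc : rCosmo M a Λ - rPlus M a Λ ≠ 0 := by linarith
  unfold mobiusZDeriv2 mobiusInvDeriv mobiusInvDeriv2
  rw [mobiusInv_sub_rMinus, ← hm]
  field_simp

/-! ### Hatsuda's weight in the `r` variable and its logarithmic derivative -/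

/-- `d/dx (x − c)^p = (x − c)^p · p/(x − c)` for `x > c` (principal power of a positive real; the
Kerr file `TeukolskyRadialHeunForm` has the same lemma as `Kerr.Costa2019.hasDerivAt_ofReal_sub_cpow`,
restated here to keep this file's imports inside the Kerr–de Sitter story). [folklore] -/
private theorem hasDerivAt_sub_cpow (c : ℝ) (p : ℂ) {r : ℝ} (hr : c < r) :
    HasDerivAt (fun x : ℝ => ((x - c : ℝ) : ℂ) ^ p)
      (((r - c : ℝ) : ℂ) ^ p * (p / ((r - c : ℝ) : ℂ))) r := by
  have hpos : (0 : ℝ) < r - c := sub_pos.2 hr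
  have hslit : ((r : ℂ) - c) ∈ slitPlane := by
    rw [← Complex.ofReal_sub]
    exact Complex.ofReal_mem_slitPlane.2 hpos
  have hne : ((r - c : ℝ) : ℂ) ≠ 0 := by exact_mod_cast hpos.ne'
  have h1 : HasDerivAt (fun z : ℂ => (z - c) ^ p) (p * ((r : ℂ) - c) ^ (p - 1) * 1) (r : ℂ) :=
    ((hasDerivAt_id (r : ℂ)).sub_const (c : ℂ)).cpow_const hslit
  have hfun : (fun x : ℝ => ((x - c : ℝ) : ℂ) ^ p) = fun y : ℝ => ((y : ℂ) - c) ^ p := by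
    funext y
    rw [Complex.ofReal_sub]
  rw [hfun]
  refine h1.comp_ofReal.congr_deriv ?_
  rw [mul_one, ← Complex.ofReal_sub, Complex.cpow_sub _ _ hne, Complex.cpow_one]
  field_simp

/-- `d/dx (c − x)^p = (c − x)^p · p/(x − c)` for `x < c` (principal power of a positive real).
[folklore] -/
private theorem hasDerivAt_const_sub_cpow (c : ℝ) (p : ℂ) {r : ℝ} (hr : r < c) :
    HasDerivAt (fun x : ℝ => ((c - x : ℝ) : ℂ) ^ p)
      (((c - r : ℝ) : ℂ) ^ p * (p / ((r - c : ℝ) : ℂ))) r := by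
  have hpos : (0 : ℝ) < c - r := sub_pos.2 hr
  have hslit : ((c : ℂ) - r) ∈ slitPlane := by
    rw [← Complex.ofReal_sub]
    exact Complex.ofReal_mem_slitPlane.2 hpos
  have hne : ((c - r : ℝ) : ℂ) ≠ 0 := by exact_mod_cast hpos.ne'
  have hne' : ((r - c : ℝ) : ℂ) ≠ 0 := by exact_mod_cast (show r - c ≠ 0 by linarith)
  have h1 : HasDerivAt (fun z : ℂ => (c - z) ^ p) (p * ((c : ℂ) - r) ^ (p - 1) * -1) (r : ℂ) :=
    ((hasDerivAt_id (r : ℂ)).const_sub (c : ℂ)).cpow_const hslit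
  have hfun : (fun x : ℝ => ((c - x : ℝ) : ℂ) ^ p) = fun y : ℝ => ((c : ℂ) - y) ^ p := by
    funext y
    rw [Complex.ofReal_sub]
  rw [hfun]
  refine h1.comp_ofReal.congr_deriv ?_
  rw [← Complex.ofReal_sub, Complex.cpow_sub _ _ hne, Complex.cpow_one]
  have e : ((r - c : ℝ) : ℂ) = -((c - r : ℝ) : ℂ) := by push_cast; ring
  rw [e]
  field_simp

/-- Hatsuda's s-homotopic weight, in the `r` variable with positive real bases on `(r₊, r_c)`:
`w(r) = (r − r₊)^{B₁} (r_c − r)^{B₂} (r − r₋')^{B₃} (r − r₋)^{B(r₋) − 2s − 1}` (principal powers).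
Since `z = z_∞(r−r₊)/(r−r₋)`, `1 − z = (r₊−r₋)(r_c−r)/((r_c−r₊)(r−r₋))`,
`z_r − z ∝ (r − r₋')/(r − r₋)`, `z_∞ − z = z_∞(r₊−r₋)/(r−r₋)` and `B₁+B₂+B₃ = −B(r₋)` (`horizonB_sum`),
this is Hatsuda's `z^{B₁}(z−1)^{B₂}(z−z_r)^{B₃}(z−z_∞)^{2s+1}` of (2.17) up to a constant non-zero
factor (constant phases and constant positive factors raised to the exponents), which does not
affect the transformed equation; its logarithmic derivative is `heunL` (`hasDerivAt_heunWeight`).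
[cite: Hatsuda2020, (2.17)–(2.18)] -/
def heunWeight (M a Λ s : ℝ) (ω : ℂ) (m : ℝ) (r : ℝ) : ℂ :=
  ((r - rPlus M a Λ : ℝ) : ℂ) ^ horizonB M a Λ ω m (rPlus M a Λ) *
    ((rCosmo M a Λ - r : ℝ) : ℂ) ^ horizonB M a Λ ω m (rCosmo M a Λ) *
    ((r - rNeg M a Λ : ℝ) : ℂ) ^ horizonB M a Λ ω m (rNeg M a Λ) *
    ((r - rMinus M a Λ : ℝ) : ℂ) ^ (horizonB M a Λ ω m (rMinus M a Λ) - (2 * s + 1))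

/-- The weight does not vanish on `(r₊, r_c)`. [cite: Hatsuda2020, (2.17)] -/
theorem heunWeight_ne_zero {M a Λ : ℝ} (hsub : IsSubextremal M a Λ) (s : ℝ) (ω : ℂ) (m : ℝ) {r : ℝ}
    (hr : r ∈ Ioo (rPlus M a Λ) (rCosmo M a Λ)) : heunWeight M a Λ s ω m r ≠ 0 := by
  obtain ⟨-, h01, h12, hw0, hr1, hr2, -⟩ := interval_facts hsub hr
  have ne : ∀ (t : ℝ) (p : ℂ), 0 < t → ((t : ℝ) : ℂ) ^ p ≠ 0 := fun t p ht h =>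
    (ht.ne' (by exact_mod_cast ((Complex.cpow_eq_zero_iff _ _).1 h).1))
  unfold heunWeight
  refine mul_ne_zero (mul_ne_zero (mul_ne_zero (ne _ _ ?_) (ne _ _ ?_)) (ne _ _ ?_)) (ne _ _ ?_) <;>
    linarith

/-- `w' = w · L` on `(r₊, r_c)`: the logarithmic derivative of the weight is
`Σ_j B_j/(r − r_j) − (2s+1)/(r − r₋) = heunL` (`heunL_eq_sum`). [cite: Hatsuda2020, (2.17)–(2.18)] -/
theorem hasDerivAt_heunWeight {M a Λ : ℝ} (hsub : IsSubextremal M a Λ) (s : ℝ) (ω : ℂ) (m : ℝ) {r : ℝ}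
    (hr : r ∈ Ioo (rPlus M a Λ) (rCosmo M a Λ)) :
    HasDerivAt (heunWeight M a Λ s ω m) (heunWeight M a Λ s ω m r * heunL M a Λ s ω m r) r := by
  obtain ⟨-, h01, h12, hw0, hr1, hr2, -⟩ := interval_facts hsub hr
  have hA := hasDerivAt_sub_cpow (rPlus M a Λ) (horizonB M a Λ ω m (rPlus M a Λ)) hr1
  have hB := hasDerivAt_const_sub_cpow (rCosmo M a Λ) (horizonB M a Λ ω m (rCosmo M a Λ)) hr2
  have hC := hasDerivAt_sub_cpow (rNeg M a Λ) (horizonB M a Λ ω m (rNeg M a Λ))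
    (show rNeg M a Λ < r by linarith)
  have hD := hasDerivAt_sub_cpow (rMinus M a Λ)
    (horizonB M a Λ ω m (rMinus M a Λ) - (2 * s + 1)) (show rMinus M a Λ < r by linarith)
  refine (((hA.mul hB).mul hC).mul hD).congr_deriv ?_
  rw [heunL_eq_sum hsub s ω m hr]
  simp only [heunWeight, Pi.mul_apply]
  ring

/-! ### The transformed equation: `R` solves the radial Teukolsky equation iff `y = (R/w)(r(z))`
solves Hatsuda's Heun equation on `(0, 1)` -/

/-- For a classical radial solution `R` on `(r₊, r_c)`, the quotient `Y = R/w` is twice differentiable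
there with `Y' = (R' − LR)/w`, `Y'' = (R'' − 2LR' + (L² − L')R)/w`, and satisfies the conjugated
equation `Δ_r Y'' + (2Δ_r L + (s+1)Δ_r')Y' + (Δ_r(L² + L') + (s+1)Δ_r' L + V)Y = 0` — the `r`-form
of Hatsuda's substitution (2.17) (`R = w Y` with `w'/w = L`). [cite: Hatsuda2020, (2.17)–(2.19)] -/
theorem weightedEquation_of_isRadialTeukolskySolution {M a Λ : ℝ} (hsub : IsSubextremal M a Λ)
    {s : ℝ} {ω : ℂ} {m : ℝ} {lam : ℂ} {R : ℝ → ℂ} (hR : IsRadialTeukolskySolution M a Λ s ω m lam R) :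
    ∃ Y₁ Y₂ : ℝ → ℂ, ∀ r ∈ Ioo (rPlus M a Λ) (rCosmo M a Λ),
      HasDerivAt (fun x => R x / heunWeight M a Λ s ω m x) (Y₁ r) r ∧ HasDerivAt Y₁ (Y₂ r) r ∧
        (delta M a Λ r : ℂ) * Y₂ r +
            (2 * (delta M a Λ r : ℂ) * heunL M a Λ s ω m r +
              ((s + 1 : ℝ) : ℂ) * (deltaDeriv M a Λ r : ℂ)) * Y₁ r +
          ((delta M a Λ r : ℂ) * (heunL M a Λ s ω m r ^ 2 + heunLDeriv M a Λ s ω m r) +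
              ((s + 1 : ℝ) : ℂ) * (deltaDeriv M a Λ r : ℂ) * heunL M a Λ s ω m r +
            radialPotential M a Λ s ω m lam r) * (R r / heunWeight M a Λ s ω m r) = 0 := by
  obtain ⟨R', R'', hR⟩ := hR
  set w := heunWeight M a Λ s ω m with hw
  set L := heunL M a Λ s ω m with hL
  set L' := heunLDeriv M a Λ s ω m with hL'
  refine ⟨fun r => (R' r - L r * R r) / w r,
    fun r => (R'' r - 2 * L r * R' r + (L r ^ 2 - L' r) * R r) / w r, fun r hr => ?_⟩
  obtain ⟨hd1, hd2, hode⟩ := hR r hr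
  have hw0 : w r ≠ 0 := heunWeight_ne_zero hsub s ω m hr
  have hwd : HasDerivAt w (w r * L r) r := hasDerivAt_heunWeight hsub s ω m hr
  have hLd : HasDerivAt L (L' r) r := hasDerivAt_heunL hsub s ω m hr
  refine ⟨?_, ?_, ?_⟩
  · refine (hd1.div hwd hw0).congr_deriv ?_
    field_simp
  · refine ((hd2.sub (hLd.mul hd1)).div hwd hw0).congr_deriv ?_
    simp only [Pi.sub_apply, Pi.mul_apply]
    field_simp
    ring
  · have key : (delta M a Λ r : ℂ) * ((R'' r - 2 * L r * R' r + (L r ^ 2 - L' r) * R r) / w r) +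
        (2 * (delta M a Λ r : ℂ) * L r + ((s + 1 : ℝ) : ℂ) * (deltaDeriv M a Λ r : ℂ)) *
          ((R' r - L r * R r) / w r) +
        ((delta M a Λ r : ℂ) * (L r ^ 2 + L' r) +
            ((s + 1 : ℝ) : ℂ) * (deltaDeriv M a Λ r : ℂ) * L r +
          radialPotential M a Λ s ω m lam r) * (R r / w r) =
        ((delta M a Λ r : ℂ) * R'' r + ((s + 1 : ℝ) : ℂ) * (deltaDeriv M a Λ r : ℂ) * R' r +
          radialPotential M a Λ s ω m lam r * R r) / w r := by
      field_simp
      ring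
    rw [key, hode, zero_div]

/-- **The Kerr–de Sitter radial Teukolsky equation IS Heun's equation, solution level** (Hatsuda
(2.17)–(2.21): "Then, the radial Teukolsky equation (2.13) is transformed into Heun's equation").
If `R` is a classical solution of the radial equation on `(r₊, r_c)`, then
`y(z) = (R/w)(r(z))` is a classical solution on `z ∈ (0, 1)` of Heun's equation with Hatsuda's data
`(a_H = z_r; α = σ₊ = 2s+1, β = σ₋; γ, δ, ε; q = v)` in Umetsu's normalisation
(`GeneralHeun.IsSolutionOn`). [cite: Hatsuda2020, (2.17)–(2.21) and (3.2)] -/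
theorem heunSolution_of_isRadialTeukolskySolution {M a Λ : ℝ} (hsub : IsSubextremal M a Λ)
    {s : ℝ} {ω : ℂ} {m : ℝ} {lam : ℂ} {R : ℝ → ℂ} (hR : IsRadialTeukolskySolution M a Λ s ω m lam R) :
    GeneralHeun.IsSolutionOn (mobiusZr M a Λ : ℂ) (heunSigmaPlus s) (heunSigmaMinus M a Λ s ω m)
      (heunGamma M a Λ s ω m) (heunDelta M a Λ s ω m) (heunEps M a Λ s ω m) (heunV M a Λ s ω m lam)
      (Ioo 0 1) (fun x => R (mobiusInv M a Λ x) / heunWeight M a Λ s ω m (mobiusInv M a Λ x)) := by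
  obtain ⟨Y₁, Y₂, hY⟩ := weightedEquation_of_isRadialTeukolskySolution hsub hR
  set ρ := mobiusInv M a Λ with hρ
  set w := heunWeight M a Λ s ω m with hw
  refine ⟨fun x => Y₁ (ρ x) * (mobiusInvDeriv M a Λ x : ℂ),
    fun x => Y₂ (ρ x) * (mobiusInvDeriv M a Λ x : ℂ) ^ 2 + Y₁ (ρ x) * (mobiusInvDeriv2 M a Λ x : ℂ),
    fun x hx => ?_⟩
  have hz1 := one_lt_mobiusZinf hsub
  have hxinf : x ≠ mobiusZinf M a Λ := ne_of_lt (hx.2.trans hz1)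
  have hxr : ρ x ∈ Ioo (rPlus M a Λ) (rCosmo M a Λ) := mobiusInv_mem_Ioo hsub hx
  obtain ⟨h1, h2, hE⟩ := hY (ρ x) hxr
  have hρd : HasDerivAt ρ (mobiusInvDeriv M a Λ x) x := hasDerivAt_mobiusInv M a Λ hxinf
  have hρdd : HasDerivAt (fun t => (mobiusInvDeriv M a Λ t : ℂ)) ((mobiusInvDeriv2 M a Λ x : ℝ) : ℂ) x :=
    (hasDerivAt_mobiusInvDeriv M a Λ hxinf).ofReal_comp
  refine ⟨?_, ?_, ?_⟩
  · have h := h1.scomp x hρd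
    refine (h.congr_deriv ?_)
    rw [Complex.real_smul]
    ring
  · have h := (h2.scomp x hρd).mul hρdd
    refine h.congr_deriv ?_
    simp only [Function.comp, Complex.real_smul]
    ring
  · have hz : mobiusZ M a Λ (ρ x) = x := mobiusZ_mobiusInv hsub hxinf
    have hlead := heun_lead_identity hsub hxr
    have hmid := heun_mid_identity hsub s ω m hxr
    have hlow := heun_low_identity hsub s ω m lam hxr
    rw [hz] at hlead hmid hlow
    have hι : (mobiusZDeriv M a Λ (ρ x) : ℂ) * (mobiusInvDeriv M a Λ x : ℂ) = 1 := by
      exact_mod_cast mobiusZDeriv_mul_mobiusInvDeriv hsub hxinf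
    have hκ : (mobiusInvDeriv2 M a Λ x : ℂ) =
        -(mobiusZDeriv2 M a Λ (ρ x) : ℂ) * (mobiusInvDeriv M a Λ x : ℂ) ^ 3 := by
      exact_mod_cast mobiusInvDeriv2_eq hsub hxinf
    have hΦ : (heunPhi M a Λ : ℂ) ≠ 0 := by
      obtain ⟨hΛ, h01, h12, hw0, -, -, -⟩ := interval_facts hsub hxr
      have : 0 < heunPhi M a Λ := by
        unfold heunPhi
        exact mul_pos (mul_pos (by positivity) (by linarith)) (by linarith)
      exact_mod_cast this.ne'
    set z' := (mobiusZDeriv M a Λ (ρ x) : ℂ) with hz'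
    set z'' := (mobiusZDeriv2 M a Λ (ρ x) : ℂ) with hz''
    set ρ' := (mobiusInvDeriv M a Λ x : ℂ) with hρ'
    set ρ'' := (mobiusInvDeriv2 M a Λ x : ℂ) with hρ''
    set D := (delta M a Λ (ρ x) : ℂ) with hD
    set P := 2 * (delta M a Λ (ρ x) : ℂ) * heunL M a Λ s ω m (ρ x) +
      ((s + 1 : ℝ) : ℂ) * (deltaDeriv M a Λ (ρ x) : ℂ) with hP
    set C₀ := (delta M a Λ (ρ x) : ℂ) * (heunL M a Λ s ω m (ρ x) ^ 2 + heunLDeriv M a Λ s ω m (ρ x)) +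
        ((s + 1 : ℝ) : ℂ) * (deltaDeriv M a Λ (ρ x) : ℂ) * heunL M a Λ s ω m (ρ x) +
      radialPotential M a Λ s ω m lam (ρ x) with hC₀
    set Y := R (ρ x) / w (ρ x) with hYdef
    have key : (heunPhi M a Λ : ℂ) *
        (GeneralHeun.lead (mobiusZr M a Λ : ℂ) x * (Y₂ (ρ x) * ρ' ^ 2 + Y₁ (ρ x) * ρ'') +
          GeneralHeun.mid (mobiusZr M a Λ : ℂ) (heunGamma M a Λ s ω m) (heunDelta M a Λ s ω m)
              (heunEps M a Λ s ω m) x * (Y₁ (ρ x) * ρ') +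
          GeneralHeun.low (heunSigmaPlus s) (heunSigmaMinus M a Λ s ω m) (heunV M a Λ s ω m lam) x *
            Y) = 0 := by
      linear_combination (-(Y₂ (ρ x) * ρ' ^ 2 + Y₁ (ρ x) * ρ'')) * hlead +
        (-(Y₁ (ρ x) * ρ')) * hmid + (-Y) * hlow + hE +
        (D * Y₂ (ρ x) * (z' * ρ' + 1) + P * Y₁ (ρ x) - D * Y₁ (ρ x) * z'' * ρ' * (z' * ρ' + 1)) * hι +
        (D * Y₁ (ρ x) * z' ^ 2) * hκ
    exact (mul_eq_zero.1 key).resolve_left hΦ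

/-- **Converse**: if `y` is a classical solution of Hatsuda's Heun equation on `z ∈ (0, 1)`, then
`R(r) = w(r) · y(z(r))` is a classical solution of the radial Teukolsky equation on `(r₊, r_c)`, with
`R' = w(L y∘z + z' y'∘z)`, `R'' = w((L²+L') y∘z + (2Lz' + z'') y'∘z + z'² y''∘z)`.
[cite: Hatsuda2020, (2.17)–(2.21) and (3.2)] -/
theorem isRadialTeukolskySolution_of_heunSolution {M a Λ : ℝ} (hsub : IsSubextremal M a Λ)
    {s : ℝ} {ω : ℂ} {m : ℝ} {lam : ℂ} {y : ℝ → ℂ}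
    (hy : GeneralHeun.IsSolutionOn (mobiusZr M a Λ : ℂ) (heunSigmaPlus s) (heunSigmaMinus M a Λ s ω m)
      (heunGamma M a Λ s ω m) (heunDelta M a Λ s ω m) (heunEps M a Λ s ω m) (heunV M a Λ s ω m lam)
      (Ioo 0 1) y) :
    IsRadialTeukolskySolution M a Λ s ω m lam
      (fun r => heunWeight M a Λ s ω m r * y (mobiusZ M a Λ r)) := by
  obtain ⟨y₁, y₂, hy⟩ := hy
  set w := heunWeight M a Λ s ω m with hw
  set L := heunL M a Λ s ω m with hL
  set L' := heunLDeriv M a Λ s ω m with hL'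
  set z := mobiusZ M a Λ with hzdef
  refine ⟨fun r => w r * (L r * y (z r) + y₁ (z r) * (mobiusZDeriv M a Λ r : ℂ)),
    fun r => w r * ((L r ^ 2 + L' r) * y (z r) +
      (2 * L r * (mobiusZDeriv M a Λ r : ℂ) + (mobiusZDeriv2 M a Λ r : ℂ)) * y₁ (z r) +
      (mobiusZDeriv M a Λ r : ℂ) ^ 2 * y₂ (z r)), fun r hr => ?_⟩
  obtain ⟨hΛ, h01, h12, hw0', hr1, hr2, hΔ⟩ := interval_facts hsub hr
  have hrm : r ≠ rMinus M a Λ := by intro h; linarith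
  have hxz : z r ∈ Ioo (0 : ℝ) 1 := mobiusZ_mem_Ioo hsub hr
  obtain ⟨k1, k2, kE⟩ := hy (z r) hxz
  have hwd : HasDerivAt w (w r * L r) r := hasDerivAt_heunWeight hsub s ω m hr
  have hLd : HasDerivAt L (L' r) r := hasDerivAt_heunL hsub s ω m hr
  have hzd : HasDerivAt z (mobiusZDeriv M a Λ r) r := hasDerivAt_mobiusZ hsub hrm
  have hzdd : HasDerivAt (fun t => (mobiusZDeriv M a Λ t : ℂ)) ((mobiusZDeriv2 M a Λ r : ℝ) : ℂ) r :=
    (hasDerivAt_mobiusZDeriv hsub hrm).ofReal_comp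
  have hyz : HasDerivAt (fun t => y (z t)) ((mobiusZDeriv M a Λ r : ℂ) * y₁ (z r)) r := by
    have h := k1.scomp r hzd
    refine h.congr_deriv ?_
    rw [Complex.real_smul]
  have hy1z : HasDerivAt (fun t => y₁ (z t)) ((mobiusZDeriv M a Λ r : ℂ) * y₂ (z r)) r := by
    have h := k2.scomp r hzd
    refine h.congr_deriv ?_
    rw [Complex.real_smul]
  refine ⟨?_, ?_, ?_⟩
  · refine (hwd.mul hyz).congr_deriv ?_
    ring
  · refine (hwd.mul (((hLd.mul hyz).add (hy1z.mul hzdd)))).congr_deriv ?_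
    simp only [Pi.add_apply, Pi.mul_apply]
    ring
  · have hlead := heun_lead_identity hsub hr
    have hmid := heun_mid_identity hsub s ω m hr
    have hlow := heun_low_identity hsub s ω m lam hr
    linear_combination (w r * y₂ (z r)) * hlead + (w r * y₁ (z r)) * hmid + (w r * y (z r)) * hlow +
      (w r * (heunPhi M a Λ : ℂ)) * kE

/-- **Equivalence.** `R` is a classical solution of the radial Teukolsky equation on `(r₊, r_c)` iff
`y = (R/w) ∘ r(·)` is a classical solution of Hatsuda's Heun equation on `(0, 1)` (the two
substitutions are inverse to each other on the open interval, where `w ≠ 0` and `r(z(r)) = r`).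
[cite: Hatsuda2020, (2.17)–(2.21) and (3.2)] -/
theorem isRadialTeukolskySolution_iff_heunSolution {M a Λ : ℝ} (hsub : IsSubextremal M a Λ)
    {s : ℝ} {ω : ℂ} {m : ℝ} {lam : ℂ} {R : ℝ → ℂ} :
    IsRadialTeukolskySolution M a Λ s ω m lam R ↔
      GeneralHeun.IsSolutionOn (mobiusZr M a Λ : ℂ) (heunSigmaPlus s) (heunSigmaMinus M a Λ s ω m)
        (heunGamma M a Λ s ω m) (heunDelta M a Λ s ω m) (heunEps M a Λ s ω m) (heunV M a Λ s ω m lam)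
        (Ioo 0 1) (fun x => R (mobiusInv M a Λ x) / heunWeight M a Λ s ω m (mobiusInv M a Λ x)) := by
  refine ⟨heunSolution_of_isRadialTeukolskySolution hsub, fun hy => ?_⟩
  obtain ⟨R', R'', h⟩ := isRadialTeukolskySolution_of_heunSolution hsub hy
  refine ⟨R', R'', fun r hr => ?_⟩
  obtain ⟨hd1, hd2, hode⟩ := h r hr
  have hw0 : heunWeight M a Λ s ω m r ≠ 0 := heunWeight_ne_zero hsub s ω m hr
  have h01 := (interval_facts hsub hr).2.1
  -- the two functions agree on the open interval
  have hagree : ∀ t ∈ Ioo (rPlus M a Λ) (rCosmo M a Λ),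
      heunWeight M a Λ s ω m t * (R (mobiusInv M a Λ (mobiusZ M a Λ t)) /
        heunWeight M a Λ s ω m (mobiusInv M a Λ (mobiusZ M a Λ t))) = R t := by
    intro t ht
    have htm : t ≠ rMinus M a Λ := by intro h'; linarith [ht.1]
    rw [mobiusInv_mobiusZ hsub htm]
    field_simp [heunWeight_ne_zero hsub s ω m ht]
  have hev : (fun t => heunWeight M a Λ s ω m t * (R (mobiusInv M a Λ (mobiusZ M a Λ t)) /
      heunWeight M a Λ s ω m (mobiusInv M a Λ (mobiusZ M a Λ t)))) =ᶠ[nhds r] R := by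
    filter_upwards [isOpen_Ioo.mem_nhds hr] with t ht using hagree t ht
  refine ⟨hd1.congr_of_eventuallyEq hev.symm |>.congr_deriv rfl, hd2, ?_⟩
  rw [← hagree r hr]
  exact hode


/-! ### The horizon boundary conditions in the `z` variable (Hatsuda §2.3, §3.1) -/

/-- **The `z^{1−γ}` branch at `z = 0`.** A function `y` on `(0, 1)` is in the exponent-`(1−γ)`
Frobenius branch at `z = 0` (`γ = heunGamma`): on some `(0, ε)` it equals `z^{1−γ} · G(z)` with `G`
`C^∞` on `(−ε, ε)` (principal power of the positive real `z`). Of Hatsuda's two local solutions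
`y₀₁ = Hl(a, q; α, β, γ, δ; z)`, `y₀₂ = z^{1−γ} Hl(a, (aδ+ε)(1−γ)+q; α+1−γ, β+1−γ, 2−γ, δ; z)` (2.24)
this is the branch of `y₀₂`, and "`R₀₂` satisfies the QNM boundary condition at the event horizon"
(3.3). [cite: Hatsuda2020, §2.3 (2.24) and §3.1 (3.3)] -/
def IsHeunBranchAtZero (M a Λ s : ℝ) (ω : ℂ) (m : ℝ) (y : ℝ → ℂ) : Prop :=
  ∃ ε : ℝ, 0 < ε ∧ ∃ G : ℝ → ℂ, ContDiffOn ℝ ((⊤ : ℕ∞) : WithTop ℕ∞) G (Ioo (-ε) ε) ∧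
    ∀ x ∈ Ioo 0 ε, y x = (x : ℂ) ^ (1 - heunGamma M a Λ s ω m) * G x

/-- **The regular branch at `z = 1`.** A function `y` on `(0, 1)` is in the exponent-`0` branch at
`z = 1`: on some `(1 − ε, 1)` it agrees with a function `C^∞` on `(1 − ε, 1 + ε)`. Of Hatsuda's
`y₁₁ = Hl(1−a, αβ−q; α, β, δ, γ; 1−z)`, `y₁₂ = (1−z)^{1−δ} Hl(…; 1−z)` (2.25) this is the branch of
`y₁₁`, and "`R₁₁` is a preferred solution" (3.4). [cite: Hatsuda2020, §2.3 (2.25) and §3.1 (3.4)] -/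
def IsHeunRegularAtOne (y : ℝ → ℂ) : Prop :=
  ∃ ε : ℝ, 0 < ε ∧ ∃ F : ℝ → ℂ, ContDiffOn ℝ ((⊤ : ℕ∞) : WithTop ℕ∞) F (Ioo (1 - ε) (1 + ε)) ∧
    ∀ x ∈ Ioo (1 - ε) 1, y x = F x

/-- **Hatsuda's two-point connection problem has a non-trivial solution** at `(ω, m, λ)`: a
classical solution `y ≢ 0` of the radial Heun equation (2.19) on `(0, 1)` in the `z^{1−γ}` branch at
`z = 0` and the regular branch at `z = 1` — "The QNM boundary condition then requires `C₂₂ = 0`",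
`C₂₂(ω) = W[y₀₂, y₁₁]/W[y₁₂, y₁₁]` (3.5). [cite: Hatsuda2020, §3.1 (3.3)–(3.5)] -/
def HasHeunConnectionSolution (M a Λ s : ℝ) (ω : ℂ) (m : ℝ) (lam : ℂ) : Prop :=
  ∃ y : ℝ → ℂ,
    GeneralHeun.IsSolutionOn (mobiusZr M a Λ : ℂ) (heunSigmaPlus s) (heunSigmaMinus M a Λ s ω m)
      (heunGamma M a Λ s ω m) (heunDelta M a Λ s ω m) (heunEps M a Λ s ω m) (heunV M a Λ s ω m lam)
      (Ioo 0 1) y ∧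
    IsHeunBranchAtZero M a Λ s ω m y ∧ IsHeunRegularAtOne y ∧ ∃ x ∈ Ioo (0 : ℝ) 1, y x ≠ 0


/-- `t ↦ t^p` (principal complex power of a positive real) is `C^∞` on `(0, ∞)`. [folklore] -/
private theorem contDiffOn_ofReal_cpow (p : ℂ) :
    ContDiffOn ℝ ((⊤ : ℕ∞) : WithTop ℕ∞) (fun t : ℝ => (t : ℂ) ^ p) (Ioi 0) := by
  intro x hx
  have hslit : ((x : ℝ) : ℂ) ∈ slitPlane := Complex.ofReal_mem_slitPlane.2 hx
  have h1 : AnalyticAt ℂ (fun z : ℂ => z ^ p) (x : ℂ) := analyticAt_id.cpow analyticAt_const hslit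
  have h3 : AnalyticAt ℝ (fun y : ℝ => (y : ℂ)) x := Complex.ofRealCLM.analyticAt x
  have h4 : AnalyticAt ℝ (fun y : ℝ => ((y : ℂ)) ^ p) x :=
    AnalyticAt.comp (g := fun z : ℂ => z ^ p) (f := fun y : ℝ => (y : ℂ)) (x := x)
      h1.restrictScalars h3
  exact h4.contDiffAt.contDiffWithinAt

/-- `x ↦ (g x)^p` is `C^∞` where the real function `g` is `C^∞` and positive. [folklore] -/
private theorem contDiffOn_ofReal_cpow_comp {g : ℝ → ℝ} {U : Set ℝ}
    (hg : ContDiffOn ℝ ((⊤ : ℕ∞) : WithTop ℕ∞) g U) (hpos : ∀ x ∈ U, 0 < g x) (p : ℂ) :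
    ContDiffOn ℝ ((⊤ : ℕ∞) : WithTop ℕ∞) (fun x => ((g x : ℝ) : ℂ) ^ p) U :=
  (contDiffOn_ofReal_cpow p).comp hg fun x hx => hpos x hx

/-- A principal power of a positive real is non-zero. [folklore] -/
private theorem ofReal_cpow_ne_zero {t : ℝ} (ht : 0 < t) (p : ℂ) : ((t : ℝ) : ℂ) ^ p ≠ 0 := fun h =>
  ht.ne' (by exact_mod_cast ((Complex.cpow_eq_zero_iff _ _).1 h).1)

/-- The inverse Möbius map is `C^∞` away from `z_∞`. [cite: Hatsuda2020, (2.15)–(2.16)] -/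
theorem contDiffOn_mobiusInv (M a Λ : ℝ) {U : Set ℝ} (hU : ∀ x ∈ U, x ≠ mobiusZinf M a Λ) :
    ContDiffOn ℝ ((⊤ : ℕ∞) : WithTop ℕ∞) (mobiusInv M a Λ) U := by
  have e : mobiusInv M a Λ = fun t => rMinus M a Λ +
      mobiusZinf M a Λ * (rPlus M a Λ - rMinus M a Λ) * (mobiusZinf M a Λ - t)⁻¹ := by
    funext t; simp only [mobiusInv, div_eq_mul_inv]
  rw [e]
  have h0 : ContDiffOn ℝ ((⊤ : ℕ∞) : WithTop ℕ∞) (fun t : ℝ => mobiusZinf M a Λ - t) U :=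
    ContDiffOn.sub contDiffOn_const contDiffOn_id
  have h1 : ContDiffOn ℝ ((⊤ : ℕ∞) : WithTop ℕ∞) (fun t : ℝ => (mobiusZinf M a Λ - t)⁻¹) U :=
    ContDiffOn.inv h0 fun x hx => sub_ne_zero.2 (Ne.symm (hU x hx))
  exact ContDiffOn.add contDiffOn_const (ContDiffOn.mul contDiffOn_const h1)

/-- A neighbourhood of `z₀ ∈ {0, 1}`-type points is mapped by `r(·)` into a prescribed neighbourhood of
`r(z₀)`: continuity of the inverse Möbius map, in `ε`–`δ` form. [folklore] -/
private theorem mobiusInv_near {M a Λ : ℝ} {x₀ : ℝ} (hx₀ : x₀ ≠ mobiusZinf M a Λ) {η : ℝ} (hη : 0 < η) :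
    ∃ δ : ℝ, 0 < δ ∧ ∀ x : ℝ, |x - x₀| < δ → |mobiusInv M a Λ x - mobiusInv M a Λ x₀| < η := by
  have hc : ContinuousAt (mobiusInv M a Λ) x₀ := (hasDerivAt_mobiusInv M a Λ hx₀).continuousAt
  obtain ⟨δ, hδ, h⟩ := Metric.continuousAt_iff.1 hc η hη
  refine ⟨δ, hδ, fun x hx => ?_⟩
  have := @h x (by rwa [Real.dist_eq])
  rwa [Real.dist_eq] at this

/-- **The outgoing condition at `𝓗⁺_c` in the `z` variable**: if `R` is outgoing at the cosmological
horizon (`IsOutgoingAtCosmoHorizon`: `R(r)(r_c − r)^{−B(r_c)}` smooth at `r_c`), then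
`y = (R/w) ∘ r(·)` agrees on a left neighbourhood of `z = 1` with a function `C^∞` on a two-sided
neighbourhood of `1` — `y` is the exponent-`0` local solution at `z = 1` (Hatsuda §3.1: of the two
local solutions `y₁₁ = Hl(1−a, αβ−q; α, β, δ, γ; 1−z)`, `y₁₂ = (1−z)^{1−δ} Hl(…; 1−z)` at `z = 1`
(2.25), "`R₁₁` is a preferred solution" (3.4)). [cite: Hatsuda2020, §2.3 (2.25) and §3.1 (3.4)] -/
theorem heunSolution_smooth_at_one {M a Λ : ℝ} (hsub : IsSubextremal M a Λ) (s : ℝ) {ω : ℂ}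
    {m : ℝ} {R : ℝ → ℂ} (hR : IsOutgoingAtCosmoHorizon M a Λ ω m R) :
    IsHeunRegularAtOne fun x => R (mobiusInv M a Λ x) / heunWeight M a Λ s ω m (mobiusInv M a Λ x) := by
  obtain ⟨ε₀, hε₀, f, hf, hRf⟩ := hR
  have hz1 := one_lt_mobiusZinf hsub
  have hρ1 := mobiusInv_one hsub
  have hsub' := hsub
  obtain ⟨-, -, h01, h12, -⟩ := hsub'
  have hw0 : rNeg M a Λ < rMinus M a Λ := by
    have := rMinus_nonneg M a Λ; simp only [rNeg]; linarith
  set ε₁ := min ε₀ (rCosmo M a Λ - rPlus M a Λ) with hε₁def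
  have hε₁ : 0 < ε₁ := lt_min hε₀ (by linarith)
  have hε₁0 : ε₁ ≤ ε₀ := min_le_left _ _
  have hε₁c : ε₁ ≤ rCosmo M a Λ - rPlus M a Λ := min_le_right _ _
  have h1ne : (1 : ℝ) ≠ mobiusZinf M a Λ := ne_of_lt hz1
  obtain ⟨δ, hδ, hδ'⟩ := mobiusInv_near (M := M) (a := a) (Λ := Λ) h1ne hε₁
  set ε := min δ (min ((mobiusZinf M a Λ - 1) / 2) 1) with hεdef
  have hε : 0 < ε := lt_min hδ (lt_min (by linarith) one_pos)
  have hεδ : ε ≤ δ := min_le_left _ _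
  have hεz : ε ≤ (mobiusZinf M a Λ - 1) / 2 := (min_le_right _ _).trans (min_le_left _ _)
  have hεone : ε ≤ 1 := (min_le_right _ _).trans (min_le_right _ _)
  -- what holds on the two-sided neighbourhood
  have hnbhd : ∀ x ∈ Ioo (1 - ε) (1 + ε), x ≠ mobiusZinf M a Λ ∧
      |mobiusInv M a Λ x - rCosmo M a Λ| < ε₁ := by
    intro x hx
    refine ⟨ne_of_lt (by linarith [hx.2]), ?_⟩
    rw [← hρ1]
    exact hδ' x (by rw [abs_lt]; constructor <;> linarith [hx.1, hx.2])
  -- the smooth, non-vanishing part of the weight near `r_c`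
  set P : ℝ → ℂ := fun r => ((r - rPlus M a Λ : ℝ) : ℂ) ^ horizonB M a Λ ω m (rPlus M a Λ) *
    ((r - rNeg M a Λ : ℝ) : ℂ) ^ horizonB M a Λ ω m (rNeg M a Λ) *
    ((r - rMinus M a Λ : ℝ) : ℂ) ^ (horizonB M a Λ ω m (rMinus M a Λ) - (2 * s + 1)) with hPdef
  have hρs : ContDiffOn ℝ ((⊤ : ℕ∞) : WithTop ℕ∞) (mobiusInv M a Λ) (Ioo (1 - ε) (1 + ε)) :=
    contDiffOn_mobiusInv M a Λ fun x hx => (hnbhd x hx).1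
  have hF1 : ContDiffOn ℝ ((⊤ : ℕ∞) : WithTop ℕ∞) (fun x => f (mobiusInv M a Λ x)) (Ioo (1 - ε) (1 + ε)) := by
    refine hf.comp hρs fun x hx => ?_
    have h := (hnbhd x hx).2
    rw [abs_lt] at h
    constructor <;> linarith [h.1, h.2]
  have hP1 := contDiffOn_ofReal_cpow_comp (hρs.sub contDiffOn_const)
    (fun x hx => show 0 < mobiusInv M a Λ x - rPlus M a Λ by
      have h := (hnbhd x hx).2; rw [abs_lt] at h; linarith [h.1])
    (horizonB M a Λ ω m (rPlus M a Λ))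
  have hP2 := contDiffOn_ofReal_cpow_comp (hρs.sub contDiffOn_const)
    (fun x hx => show 0 < mobiusInv M a Λ x - rNeg M a Λ by
      have h := (hnbhd x hx).2; rw [abs_lt] at h; linarith [h.1])
    (horizonB M a Λ ω m (rNeg M a Λ))
  have hP3 := contDiffOn_ofReal_cpow_comp (hρs.sub contDiffOn_const)
    (fun x hx => show 0 < mobiusInv M a Λ x - rMinus M a Λ by
      have h := (hnbhd x hx).2; rw [abs_lt] at h; linarith [h.1])
    (horizonB M a Λ ω m (rMinus M a Λ) - (2 * s + 1))
  have hF2 : ContDiffOn ℝ ((⊤ : ℕ∞) : WithTop ℕ∞) (fun x => P (mobiusInv M a Λ x)) (Ioo (1 - ε) (1 + ε)) :=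
    (hP1.mul hP2).mul hP3
  have hF2ne : ∀ x ∈ Ioo (1 - ε) (1 + ε), P (mobiusInv M a Λ x) ≠ 0 := by
    intro x hx
    have h := (hnbhd x hx).2
    rw [abs_lt] at h
    exact mul_ne_zero (mul_ne_zero (ofReal_cpow_ne_zero (by linarith [h.1]) _)
      (ofReal_cpow_ne_zero (by linarith [h.1]) _)) (ofReal_cpow_ne_zero (by linarith [h.1]) _)
  refine ⟨ε, hε, fun x => f (mobiusInv M a Λ x) * (P (mobiusInv M a Λ x))⁻¹,
    hF1.mul (hF2.inv hF2ne), ?_⟩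
  · intro x hx
    beta_reduce
    have hx' : x ∈ Ioo (1 - ε) (1 + ε) := ⟨hx.1, by linarith [hx.2]⟩
    have hx01 : x ∈ Ioo (0 : ℝ) 1 := ⟨by linarith [hx.1], hx.2⟩
    have hr := mobiusInv_mem_Ioo hsub hx01
    set r := mobiusInv M a Λ x with hrdef
    have h := (hnbhd x hx').2
    rw [abs_lt] at h
    have hrc : r ∈ Ioo (rCosmo M a Λ - ε₀) (rCosmo M a Λ) := ⟨by linarith [h.1], hr.2⟩
    have e := hRf r hrc
    have hb : ((rCosmo M a Λ - r : ℝ) : ℂ) ^ horizonB M a Λ ω m (rCosmo M a Λ) ≠ 0 :=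
      ofReal_cpow_ne_zero (by linarith [hr.2]) _
    have hP0 : P r ≠ 0 :=
      mul_ne_zero (mul_ne_zero (ofReal_cpow_ne_zero (by linarith [hr.1]) _)
        (ofReal_cpow_ne_zero (by linarith [hr.1]) _)) (ofReal_cpow_ne_zero (by linarith [hr.1]) _)
    rw [← e, Complex.cpow_neg]
    simp only [hPdef, heunWeight]
    field_simp

/-- **The ingoing condition at `𝓗⁺` in the `z` variable**: if `R` is ingoing at the event horizon
(`IsIngoingAtEventHorizon`: `R(r)(r − r₊)^{s+B(r₊)}` smooth at `r₊`), then on a right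
neighbourhood of `z = 0`, `y = (R/w) ∘ r(·) = z^{1−γ} · G` with `G` `C^∞` on a two-sided
neighbourhood of `0` — `y` is the exponent-`(1−γ)` local solution at `z = 0`
(`1 − γ = −2B₁ − s`; Hatsuda §2.3 (2.24): `y₀₁ = Hl(a, q; α, β, γ, δ; z)`,
`y₀₂ = z^{1−γ} Hl(a, (aδ+ε)(1−γ)+q; α+1−γ, β+1−γ, 2−γ, δ; z)`, and §3.1 (3.3): "`R₀₂` satisfies the
QNM boundary condition at the event horizon"). [cite: Hatsuda2020, §2.3 (2.24) and §3.1 (3.3)] -/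
theorem heunSolution_branch_at_zero {M a Λ : ℝ} (hsub : IsSubextremal M a Λ) {s : ℝ} {ω : ℂ}
    {m : ℝ} {R : ℝ → ℂ} (hR : IsIngoingAtEventHorizon M a Λ s ω m R) :
    IsHeunBranchAtZero M a Λ s ω m fun x =>
      R (mobiusInv M a Λ x) / heunWeight M a Λ s ω m (mobiusInv M a Λ x) := by
  obtain ⟨ε₀, hε₀, f, hf, hRf⟩ := hR
  have hz1 := one_lt_mobiusZinf hsub
  have hρ0 := mobiusInv_zero hsub
  have hsub' := hsub
  obtain ⟨-, -, h01, h12, -⟩ := hsub'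
  have hw0 : rNeg M a Λ < rMinus M a Λ := by
    have := rMinus_nonneg M a Λ; simp only [rNeg]; linarith
  set ε₁ := min ε₀ (min (rCosmo M a Λ - rPlus M a Λ) (rPlus M a Λ - rMinus M a Λ)) with hε₁def
  have hε₁ : 0 < ε₁ := lt_min hε₀ (lt_min (by linarith) (by linarith))
  have hε₁0 : ε₁ ≤ ε₀ := min_le_left _ _
  have hε₁c : ε₁ ≤ rCosmo M a Λ - rPlus M a Λ := (min_le_right _ _).trans (min_le_left _ _)
  have hε₁m : ε₁ ≤ rPlus M a Λ - rMinus M a Λ := (min_le_right _ _).trans (min_le_right _ _)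
  have h0ne : (0 : ℝ) ≠ mobiusZinf M a Λ := ne_of_lt (by linarith)
  obtain ⟨δ, hδ, hδ'⟩ := mobiusInv_near (M := M) (a := a) (Λ := Λ) h0ne hε₁
  set ε := min δ 1 with hεdef
  have hε : 0 < ε := lt_min hδ one_pos
  have hεδ : ε ≤ δ := min_le_left _ _
  have hεone : ε ≤ 1 := min_le_right _ _
  have hnbhd : ∀ x ∈ Ioo (-ε) ε, x < mobiusZinf M a Λ ∧ |mobiusInv M a Λ x - rPlus M a Λ| < ε₁ := by
    intro x hx
    refine ⟨by linarith [hx.2], ?_⟩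
    rw [← hρ0]
    exact hδ' x (by rw [sub_zero, abs_lt]; constructor <;> linarith [hx.1, hx.2])
  -- the smooth, non-vanishing part of the weight near `r₊`, and the positive factor `κ = (r−r₊)/z`
  set Q : ℝ → ℂ := fun r => ((rCosmo M a Λ - r : ℝ) : ℂ) ^ horizonB M a Λ ω m (rCosmo M a Λ) *
    ((r - rNeg M a Λ : ℝ) : ℂ) ^ horizonB M a Λ ω m (rNeg M a Λ) *
    ((r - rMinus M a Λ : ℝ) : ℂ) ^ (horizonB M a Λ ω m (rMinus M a Λ) - (2 * s + 1)) with hQdef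
  set κ : ℝ → ℝ := fun x => (rPlus M a Λ - rMinus M a Λ) / (mobiusZinf M a Λ - x) with hκdef
  have hκpos : ∀ x ∈ Ioo (-ε) ε, 0 < κ x := fun x hx =>
    div_pos (by linarith) (by linarith [(hnbhd x hx).1])
  have hρs : ContDiffOn ℝ ((⊤ : ℕ∞) : WithTop ℕ∞) (mobiusInv M a Λ) (Ioo (-ε) ε) :=
    contDiffOn_mobiusInv M a Λ fun x hx => ne_of_lt (hnbhd x hx).1
  have hκs : ContDiffOn ℝ ((⊤ : ℕ∞) : WithTop ℕ∞) κ (Ioo (-ε) ε) :=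
    contDiffOn_const.div (contDiffOn_const.sub contDiffOn_id) fun x hx => by
      have := (hnbhd x hx).1; exact sub_ne_zero.2 (ne_of_gt this)
  have hG : ContDiffOn ℝ ((⊤ : ℕ∞) : WithTop ℕ∞) (fun x => ((κ x : ℝ) : ℂ) ^ (1 - heunGamma M a Λ s ω m) *
      f (mobiusInv M a Λ x) * (Q (mobiusInv M a Λ x))⁻¹) (Ioo (-ε) ε) := by
    have hG1 := contDiffOn_ofReal_cpow_comp hκs hκpos (1 - heunGamma M a Λ s ω m)
    have hG2 : ContDiffOn ℝ ((⊤ : ℕ∞) : WithTop ℕ∞) (fun x => f (mobiusInv M a Λ x)) (Ioo (-ε) ε) := by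
      refine hf.comp hρs fun x hx => ?_
      have h := (hnbhd x hx).2
      rw [abs_lt] at h
      constructor <;> linarith [h.1, h.2]
    have hQ1 := contDiffOn_ofReal_cpow_comp (contDiffOn_const.sub hρs)
      (fun x hx => show 0 < rCosmo M a Λ - mobiusInv M a Λ x by
        have h := (hnbhd x hx).2; rw [abs_lt] at h; linarith [h.2])
      (horizonB M a Λ ω m (rCosmo M a Λ))
    have hQ2 := contDiffOn_ofReal_cpow_comp (hρs.sub contDiffOn_const)
      (fun x hx => show 0 < mobiusInv M a Λ x - rNeg M a Λ by
        have h := (hnbhd x hx).2; rw [abs_lt] at h; linarith [h.1])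
      (horizonB M a Λ ω m (rNeg M a Λ))
    have hQ3 := contDiffOn_ofReal_cpow_comp (hρs.sub contDiffOn_const)
      (fun x hx => show 0 < mobiusInv M a Λ x - rMinus M a Λ by
        have h := (hnbhd x hx).2; rw [abs_lt] at h; linarith [h.1])
      (horizonB M a Λ ω m (rMinus M a Λ) - (2 * s + 1))
    have hG3 : ContDiffOn ℝ ((⊤ : ℕ∞) : WithTop ℕ∞) (fun x => Q (mobiusInv M a Λ x)) (Ioo (-ε) ε) :=
      (hQ1.mul hQ2).mul hQ3
    have hG3ne : ∀ x ∈ Ioo (-ε) ε, Q (mobiusInv M a Λ x) ≠ 0 := by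
      intro x hx
      have h := (hnbhd x hx).2
      rw [abs_lt] at h
      exact mul_ne_zero (mul_ne_zero (ofReal_cpow_ne_zero (by linarith [h.2]) _)
        (ofReal_cpow_ne_zero (by linarith [h.1]) _)) (ofReal_cpow_ne_zero (by linarith [h.1]) _)
    exact (hG1.mul hG2).mul (hG3.inv hG3ne)
  refine ⟨ε, hε, fun x => ((κ x : ℝ) : ℂ) ^ (1 - heunGamma M a Λ s ω m) *
    f (mobiusInv M a Λ x) * (Q (mobiusInv M a Λ x))⁻¹, hG, ?_⟩
  · intro x hx
    beta_reduce
    have hx' : x ∈ Ioo (-ε) ε := ⟨by linarith [hx.1], hx.2⟩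
    have hx01 : x ∈ Ioo (0 : ℝ) 1 := ⟨hx.1, by linarith [hx.2]⟩
    have hxinf : x ≠ mobiusZinf M a Λ := ne_of_lt (hnbhd x hx').1
    have hr := mobiusInv_mem_Ioo hsub hx01
    have hκx := hκpos x hx'
    have hsubr : mobiusInv M a Λ x - rPlus M a Λ = x * κ x := by
      rw [mobiusInv_sub_rPlus hxinf]; simp only [hκdef]; ring
    set r := mobiusInv M a Λ x with hrdef
    have h := (hnbhd x hx').2
    rw [abs_lt] at h
    have hrp : r ∈ Ioo (rPlus M a Λ) (rPlus M a Λ + ε₀) := ⟨hr.1, by linarith [h.2]⟩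
    have e := hRf r hrp
    set b : ℂ := ((r - rPlus M a Λ : ℝ) : ℂ) with hbdef
    have hb0 : b ≠ 0 := by rw [hbdef]; exact_mod_cast (show r - rPlus M a Λ ≠ 0 by linarith [hr.1])
    have hS : b ^ ((s : ℂ) + horizonB M a Λ ω m (rPlus M a Λ)) ≠ 0 :=
      ofReal_cpow_ne_zero (by linarith [hr.1]) _
    have hB : b ^ horizonB M a Λ ω m (rPlus M a Λ) ≠ 0 := ofReal_cpow_ne_zero (by linarith [hr.1]) _
    have hQ0 : Q r ≠ 0 :=
      mul_ne_zero (mul_ne_zero (ofReal_cpow_ne_zero (by linarith [hr.2]) _)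
        (ofReal_cpow_ne_zero (by linarith [hr.1]) _)) (ofReal_cpow_ne_zero (by linarith [hr.1]) _)
    -- `b^{s+B₁} · b^{B₁} · b^{1−γ} = b⁰ = 1`
    have hprod : b ^ ((s : ℂ) + horizonB M a Λ ω m (rPlus M a Λ)) * b ^ horizonB M a Λ ω m (rPlus M a Λ) *
        b ^ (1 - heunGamma M a Λ s ω m) = 1 := by
      rw [← Complex.cpow_add _ _ hb0, ← Complex.cpow_add _ _ hb0]
      have : (s : ℂ) + horizonB M a Λ ω m (rPlus M a Λ) + horizonB M a Λ ω m (rPlus M a Λ) +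
          (1 - heunGamma M a Λ s ω m) = 0 := by
        unfold heunGamma; ring
      rw [this, Complex.cpow_zero]
    -- `b^{1−γ} = z^{1−γ} κ^{1−γ}` (product of non-negative reals)
    have hsplit : b ^ (1 - heunGamma M a Λ s ω m) =
        (x : ℂ) ^ (1 - heunGamma M a Λ s ω m) * ((κ x : ℝ) : ℂ) ^ (1 - heunGamma M a Λ s ω m) := by
      rw [hbdef, hsubr, Complex.ofReal_mul]
      exact Complex.mul_cpow_ofReal_nonneg hx.1.le hκx.le _
    have eR : R r = f r * (b ^ ((s : ℂ) + horizonB M a Λ ω m (rPlus M a Λ)))⁻¹ := by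
      rw [← e]; field_simp
    have hBT : b ^ horizonB M a Λ ω m (rPlus M a Λ) * b ^ (1 - heunGamma M a Λ s ω m) =
        (b ^ ((s : ℂ) + horizonB M a Λ ω m (rPlus M a Λ)))⁻¹ :=
      eq_inv_of_mul_eq_one_right (by rw [← mul_assoc]; exact hprod)
    rw [eR, ← hBT, hsplit]
    simp only [hQdef, heunWeight]
    rw [← hbdef]
    field_simp


/-! ### Converse boundary translations: Heun branch data at `z = 0, 1` give the horizon conditions
for `R = w · (y ∘ z)` -/

/-- The Möbius map `z` is `C^∞` away from `r₋`. [cite: Hatsuda2020, (2.15)] -/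
theorem contDiffOn_mobiusZ (M a Λ : ℝ) {U : Set ℝ} (hU : ∀ r ∈ U, r ≠ rMinus M a Λ) :
    ContDiffOn ℝ ((⊤ : ℕ∞) : WithTop ℕ∞) (mobiusZ M a Λ) U := by
  have e : mobiusZ M a Λ = fun t => mobiusZinf M a Λ * ((t - rPlus M a Λ) * (t - rMinus M a Λ)⁻¹) := by
    funext t; rw [mobiusZ_eq_zinf_mul, div_eq_mul_inv]
  rw [e]
  have h0 : ContDiffOn ℝ ((⊤ : ℕ∞) : WithTop ℕ∞) (fun t : ℝ => t - rMinus M a Λ) U :=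
    ContDiffOn.sub contDiffOn_id contDiffOn_const
  have h1 : ContDiffOn ℝ ((⊤ : ℕ∞) : WithTop ℕ∞) (fun t : ℝ => (t - rMinus M a Λ)⁻¹) U :=
    ContDiffOn.inv h0 fun x hx => sub_ne_zero.2 (hU x hx)
  have h2 : ContDiffOn ℝ ((⊤ : ℕ∞) : WithTop ℕ∞) (fun t : ℝ => t - rPlus M a Λ) U :=
    ContDiffOn.sub contDiffOn_id contDiffOn_const
  exact ContDiffOn.mul contDiffOn_const (ContDiffOn.mul h2 h1)

/-- Continuity of the Möbius map in `ε`–`δ` form. [folklore] -/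
private theorem mobiusZ_near {M a Λ : ℝ} (hsub : IsSubextremal M a Λ) {r₀ : ℝ} (hr₀ : r₀ ≠ rMinus M a Λ)
    {η : ℝ} (hη : 0 < η) :
    ∃ δ : ℝ, 0 < δ ∧ ∀ r : ℝ, |r - r₀| < δ → |mobiusZ M a Λ r - mobiusZ M a Λ r₀| < η := by
  have hc : ContinuousAt (mobiusZ M a Λ) r₀ := (hasDerivAt_mobiusZ hsub hr₀).continuousAt
  obtain ⟨δ, hδ, h⟩ := Metric.continuousAt_iff.1 hc η hη
  refine ⟨δ, hδ, fun x hx => ?_⟩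
  have := @h x (by rwa [Real.dist_eq])
  rwa [Real.dist_eq] at this

/-- **Converse at `𝓗⁺_c`**: if the Heun-side function `y` agrees on a left neighbourhood of `z = 1`
with a function `C^∞` on a two-sided neighbourhood of `1` (the regular branch `y₁₁`), then
`R = w · (y ∘ z)` is outgoing at the cosmological horizon in the sense of `IsOutgoingAtCosmoHorizon`
(`R(r)(r_c − r)^{−B₂}` smooth at `r_c`). [cite: Hatsuda2020, §2.3 (2.25) and §3.1 (3.4)] -/
theorem isOutgoingAtCosmoHorizon_of_heun_smooth_at_one {M a Λ : ℝ} (hsub : IsSubextremal M a Λ)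
    (s : ℝ) (ω : ℂ) (m : ℝ) {y : ℝ → ℂ} (hy : IsHeunRegularAtOne y) :
    IsOutgoingAtCosmoHorizon M a Λ ω m (fun r => heunWeight M a Λ s ω m r * y (mobiusZ M a Λ r)) := by
  obtain ⟨ε, hε, F, hF, hyF⟩ := hy
  have hz1 := one_lt_mobiusZinf hsub
  have hzc := mobiusZ_rCosmo hsub
  have hsub' := hsub
  obtain ⟨-, -, h01, h12, -⟩ := hsub'
  have hw0 : rNeg M a Λ < rMinus M a Λ := by
    have := rMinus_nonneg M a Λ; simp only [rNeg]; linarith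
  have hcne : rCosmo M a Λ ≠ rMinus M a Λ := by intro h; linarith
  obtain ⟨δ, hδ, hδ'⟩ := mobiusZ_near hsub hcne hε
  set ε' := min δ (rCosmo M a Λ - rPlus M a Λ) with hε'def
  have hε' : 0 < ε' := lt_min hδ (by linarith)
  have hε'δ : ε' ≤ δ := min_le_left _ _
  have hε'c : ε' ≤ rCosmo M a Λ - rPlus M a Λ := min_le_right _ _
  have hnbhd : ∀ r ∈ Ioo (rCosmo M a Λ - ε') (rCosmo M a Λ + ε'),
      rPlus M a Λ < r ∧ mobiusZ M a Λ r ∈ Ioo (1 - ε) (1 + ε) := by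
    intro r hr
    refine ⟨by linarith [hr.1], ?_⟩
    have h := hδ' r (by rw [abs_lt]; constructor <;> linarith [hr.1, hr.2])
    rw [hzc, abs_lt] at h
    constructor <;> linarith [h.1, h.2]
  set P : ℝ → ℂ := fun r => ((r - rPlus M a Λ : ℝ) : ℂ) ^ horizonB M a Λ ω m (rPlus M a Λ) *
    ((r - rNeg M a Λ : ℝ) : ℂ) ^ horizonB M a Λ ω m (rNeg M a Λ) *
    ((r - rMinus M a Λ : ℝ) : ℂ) ^ (horizonB M a Λ ω m (rMinus M a Λ) - (2 * s + 1)) with hPdef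
  have hU : ∀ r ∈ Ioo (rCosmo M a Λ - ε') (rCosmo M a Λ + ε'), r ≠ rMinus M a Λ := fun r hr => by
    intro h; linarith [(hnbhd r hr).1]
  have hzs := contDiffOn_mobiusZ M a Λ hU
  have hP1 := contDiffOn_ofReal_cpow_comp (ContDiffOn.sub contDiffOn_id contDiffOn_const)
    (fun r hr => show 0 < id r - rPlus M a Λ by simpa using (hnbhd r hr).1)
    (horizonB M a Λ ω m (rPlus M a Λ)) (U := Ioo (rCosmo M a Λ - ε') (rCosmo M a Λ + ε'))
  have hP2 := contDiffOn_ofReal_cpow_comp (ContDiffOn.sub contDiffOn_id contDiffOn_const)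
    (fun r hr => show 0 < id r - rNeg M a Λ by have := (hnbhd r hr).1; simp only [id]; linarith)
    (horizonB M a Λ ω m (rNeg M a Λ)) (U := Ioo (rCosmo M a Λ - ε') (rCosmo M a Λ + ε'))
  have hP3 := contDiffOn_ofReal_cpow_comp (ContDiffOn.sub contDiffOn_id contDiffOn_const)
    (fun r hr => show 0 < id r - rMinus M a Λ by have := (hnbhd r hr).1; simp only [id]; linarith)
    (horizonB M a Λ ω m (rMinus M a Λ) - (2 * s + 1)) (U := Ioo (rCosmo M a Λ - ε') (rCosmo M a Λ + ε'))
  have hPs : ContDiffOn ℝ ((⊤ : ℕ∞) : WithTop ℕ∞) P (Ioo (rCosmo M a Λ - ε') (rCosmo M a Λ + ε')) := by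
    simpa only [hPdef, id] using (hP1.mul hP2).mul hP3
  have hFz : ContDiffOn ℝ ((⊤ : ℕ∞) : WithTop ℕ∞) (fun r => F (mobiusZ M a Λ r))
      (Ioo (rCosmo M a Λ - ε') (rCosmo M a Λ + ε')) :=
    hF.comp hzs fun r hr => (hnbhd r hr).2
  refine ⟨ε', hε', fun r => P r * F (mobiusZ M a Λ r), hPs.mul hFz, fun r hr => ?_⟩
  beta_reduce
  have hr' : r ∈ Ioo (rCosmo M a Λ - ε') (rCosmo M a Λ + ε') := ⟨hr.1, by linarith [hr.2]⟩
  have hrI : r ∈ Ioo (rPlus M a Λ) (rCosmo M a Λ) := ⟨(hnbhd r hr').1, hr.2⟩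
  have hx : mobiusZ M a Λ r ∈ Ioo (1 - ε) 1 := ⟨(hnbhd r hr').2.1, (mobiusZ_mem_Ioo hsub hrI).2⟩
  rw [hyF _ hx, Complex.cpow_neg]
  have hb : ((rCosmo M a Λ - r : ℝ) : ℂ) ^ horizonB M a Λ ω m (rCosmo M a Λ) ≠ 0 :=
    ofReal_cpow_ne_zero (by linarith [hr.2]) _
  simp only [hPdef, heunWeight]
  field_simp

/-- **Converse at `𝓗⁺`**: if on a right neighbourhood of `z = 0` the Heun-side function is
`y = z^{1−γ} · G` with `G` `C^∞` on a two-sided neighbourhood of `0` (the branch `y₀₂`), then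
`R = w · (y ∘ z)` is ingoing at the event horizon in the sense of `IsIngoingAtEventHorizon`
(`R(r)(r − r₊)^{s+B₁}` smooth at `r₊`; here `z = (r − r₊)·z_∞/(r − r₋)` and
`B₁ + (1−γ) + (s + B₁) = 0`). [cite: Hatsuda2020, §2.3 (2.24) and §3.1 (3.3)] -/
theorem isIngoingAtEventHorizon_of_heun_branch_at_zero {M a Λ : ℝ} (hsub : IsSubextremal M a Λ)
    (s : ℝ) (ω : ℂ) (m : ℝ) {y : ℝ → ℂ} (hy : IsHeunBranchAtZero M a Λ s ω m y) :
    IsIngoingAtEventHorizon M a Λ s ω m (fun r => heunWeight M a Λ s ω m r * y (mobiusZ M a Λ r)) := by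
  obtain ⟨ε, hε, G, hG, hyG⟩ := hy
  have hz1 := one_lt_mobiusZinf hsub
  have hz0 := mobiusZ_rPlus M a Λ
  have hsub' := hsub
  obtain ⟨-, -, h01, h12, -⟩ := hsub'
  have hw0 : rNeg M a Λ < rMinus M a Λ := by
    have := rMinus_nonneg M a Λ; simp only [rNeg]; linarith
  have hpne : rPlus M a Λ ≠ rMinus M a Λ := by intro h; linarith
  obtain ⟨δ, hδ, hδ'⟩ := mobiusZ_near hsub hpne hε
  set ε' := min δ (min (rCosmo M a Λ - rPlus M a Λ) (rPlus M a Λ - rMinus M a Λ)) with hε'def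
  have hε' : 0 < ε' := lt_min hδ (lt_min (by linarith) (by linarith))
  have hε'δ : ε' ≤ δ := min_le_left _ _
  have hε'c : ε' ≤ rCosmo M a Λ - rPlus M a Λ := (min_le_right _ _).trans (min_le_left _ _)
  have hε'm : ε' ≤ rPlus M a Λ - rMinus M a Λ := (min_le_right _ _).trans (min_le_right _ _)
  have hnbhd : ∀ r ∈ Ioo (rPlus M a Λ - ε') (rPlus M a Λ + ε'),
      rMinus M a Λ < r ∧ r < rCosmo M a Λ ∧ mobiusZ M a Λ r ∈ Ioo (-ε) ε := by
    intro r hr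
    refine ⟨by linarith [hr.1], by linarith [hr.2], ?_⟩
    have h := hδ' r (by rw [abs_lt]; constructor <;> linarith [hr.1, hr.2])
    rw [hz0, sub_zero, abs_lt] at h
    exact h
  -- `Q` = the weight without its `(r − r₊)` factor; `μ = z/(r − r₊) = z_∞/(r − r₋)`
  set Q : ℝ → ℂ := fun r => ((rCosmo M a Λ - r : ℝ) : ℂ) ^ horizonB M a Λ ω m (rCosmo M a Λ) *
    ((r - rNeg M a Λ : ℝ) : ℂ) ^ horizonB M a Λ ω m (rNeg M a Λ) *
    ((r - rMinus M a Λ : ℝ) : ℂ) ^ (horizonB M a Λ ω m (rMinus M a Λ) - (2 * s + 1)) with hQdef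
  set μ : ℝ → ℝ := fun r => mobiusZinf M a Λ / (r - rMinus M a Λ) with hμdef
  have hμpos : ∀ r ∈ Ioo (rPlus M a Λ - ε') (rPlus M a Λ + ε'), 0 < μ r := fun r hr =>
    div_pos (by linarith) (by linarith [(hnbhd r hr).1])
  have hU : ∀ r ∈ Ioo (rPlus M a Λ - ε') (rPlus M a Λ + ε'), r ≠ rMinus M a Λ := fun r hr => by
    intro h; linarith [(hnbhd r hr).1]
  have hzs := contDiffOn_mobiusZ M a Λ hU
  have hμs : ContDiffOn ℝ ((⊤ : ℕ∞) : WithTop ℕ∞) μ (Ioo (rPlus M a Λ - ε') (rPlus M a Λ + ε')) :=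
    ContDiffOn.div contDiffOn_const (ContDiffOn.sub contDiffOn_id contDiffOn_const)
      fun r hr => sub_ne_zero.2 (hU r hr)
  have hQ1 := contDiffOn_ofReal_cpow_comp (ContDiffOn.sub contDiffOn_const contDiffOn_id)
    (fun r hr => show 0 < rCosmo M a Λ - id r by have := (hnbhd r hr).2.1; simp only [id]; linarith)
    (horizonB M a Λ ω m (rCosmo M a Λ)) (U := Ioo (rPlus M a Λ - ε') (rPlus M a Λ + ε'))
  have hQ2 := contDiffOn_ofReal_cpow_comp (ContDiffOn.sub contDiffOn_id contDiffOn_const)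
    (fun r hr => show 0 < id r - rNeg M a Λ by have := (hnbhd r hr).1; simp only [id]; linarith)
    (horizonB M a Λ ω m (rNeg M a Λ)) (U := Ioo (rPlus M a Λ - ε') (rPlus M a Λ + ε'))
  have hQ3 := contDiffOn_ofReal_cpow_comp (ContDiffOn.sub contDiffOn_id contDiffOn_const)
    (fun r hr => show 0 < id r - rMinus M a Λ by have := (hnbhd r hr).1; simp only [id]; linarith)
    (horizonB M a Λ ω m (rMinus M a Λ) - (2 * s + 1)) (U := Ioo (rPlus M a Λ - ε') (rPlus M a Λ + ε'))
  have hQs : ContDiffOn ℝ ((⊤ : ℕ∞) : WithTop ℕ∞) Q (Ioo (rPlus M a Λ - ε') (rPlus M a Λ + ε')) := by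
    simpa only [hQdef, id] using (hQ1.mul hQ2).mul hQ3
  have hμp := contDiffOn_ofReal_cpow_comp hμs hμpos (1 - heunGamma M a Λ s ω m)
  have hGz : ContDiffOn ℝ ((⊤ : ℕ∞) : WithTop ℕ∞) (fun r => G (mobiusZ M a Λ r))
      (Ioo (rPlus M a Λ - ε') (rPlus M a Λ + ε')) :=
    hG.comp hzs fun r hr => (hnbhd r hr).2.2
  refine ⟨ε', hε', fun r => Q r * ((μ r : ℝ) : ℂ) ^ (1 - heunGamma M a Λ s ω m) * G (mobiusZ M a Λ r),
    (hQs.mul hμp).mul hGz, fun r hr => ?_⟩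
  beta_reduce
  have hr' : r ∈ Ioo (rPlus M a Λ - ε') (rPlus M a Λ + ε') := ⟨by linarith [hr.1], hr.2⟩
  have hrI : r ∈ Ioo (rPlus M a Λ) (rCosmo M a Λ) := ⟨hr.1, (hnbhd r hr').2.1⟩
  have hx : mobiusZ M a Λ r ∈ Ioo 0 ε := ⟨(mobiusZ_mem_Ioo hsub hrI).1, (hnbhd r hr').2.2.2⟩
  rw [hyG _ hx]
  have hμr := hμpos r hr'
  have hzfac : mobiusZ M a Λ r = (r - rPlus M a Λ) * μ r := by
    rw [mobiusZ_eq_zinf_mul]; simp only [hμdef]; ring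
  set b : ℂ := ((r - rPlus M a Λ : ℝ) : ℂ) with hbdef
  have hb0 : b ≠ 0 := by rw [hbdef]; exact_mod_cast (show r - rPlus M a Λ ≠ 0 by linarith [hr.1])
  have hsplit : ((mobiusZ M a Λ r : ℝ) : ℂ) ^ (1 - heunGamma M a Λ s ω m) =
      b ^ (1 - heunGamma M a Λ s ω m) * ((μ r : ℝ) : ℂ) ^ (1 - heunGamma M a Λ s ω m) := by
    rw [hzfac, Complex.ofReal_mul, hbdef]
    exact Complex.mul_cpow_ofReal_nonneg (by linarith [hr.1]) hμr.le _
  have hprod : b ^ horizonB M a Λ ω m (rPlus M a Λ) * b ^ (1 - heunGamma M a Λ s ω m) *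
      b ^ ((s : ℂ) + horizonB M a Λ ω m (rPlus M a Λ)) = 1 := by
    rw [← Complex.cpow_add _ _ hb0, ← Complex.cpow_add _ _ hb0]
    have : horizonB M a Λ ω m (rPlus M a Λ) + (1 - heunGamma M a Λ s ω m) +
        ((s : ℂ) + horizonB M a Λ ω m (rPlus M a Λ)) = 0 := by
      unfold heunGamma; ring
    rw [this, Complex.cpow_zero]
  rw [hsplit]
  simp only [hQdef, heunWeight]
  rw [← hbdef]
  linear_combination (((rCosmo M a Λ - r : ℝ) : ℂ) ^ horizonB M a Λ ω m (rCosmo M a Λ) *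
    ((r - rNeg M a Λ : ℝ) : ℂ) ^ horizonB M a Λ ω m (rNeg M a Λ) *
    ((r - rMinus M a Λ : ℝ) : ℂ) ^ (horizonB M a Λ ω m (rMinus M a Λ) - (2 * s + 1)) *
    ((μ r : ℝ) : ℂ) ^ (1 - heunGamma M a Λ s ω m) * G (mobiusZ M a Λ r)) * hprod


/-! ### Mode solutions = non-trivial solutions of Hatsuda's connection problem -/

/-- A mode solution `R` (CTdC Def. 3.4 as transcribed in `IsModeSolution`: angular eigenvalue,
radial solution on `(r₊, r_c)`, ingoing at `𝓗⁺`, outgoing at `𝓗⁺_c`, `R ≢ 0`) gives a non-trivial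
solution `y = (R/w) ∘ r(·)` of Hatsuda's two-point connection problem for the radial Heun equation.
[cite: Hatsuda2020, §3.1 (3.2)–(3.5)] -/
theorem hasHeunConnectionSolution_of_isModeSolution {M a Λ : ℝ} (hsub : IsSubextremal M a Λ)
    {s : ℝ} {ω : ℂ} {m : ℝ} {lam : ℂ} {R : ℝ → ℂ} (hR : IsModeSolution M a Λ s ω m lam R) :
    HasHeunConnectionSolution M a Λ s ω m lam := by
  obtain ⟨-, hrad, hin, hout, r₀, hr₀, hR₀⟩ := hR
  refine ⟨fun x => R (mobiusInv M a Λ x) / heunWeight M a Λ s ω m (mobiusInv M a Λ x),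
    heunSolution_of_isRadialTeukolskySolution hsub hrad, heunSolution_branch_at_zero hsub hin,
    heunSolution_smooth_at_one hsub s hout, mobiusZ M a Λ r₀, mobiusZ_mem_Ioo hsub hr₀, ?_⟩
  have hr₀m : r₀ ≠ rMinus M a Λ := by intro h; linarith [hr₀.1, (interval_facts hsub hr₀).2.1]
  beta_reduce
  rw [mobiusInv_mobiusZ hsub hr₀m]
  exact div_ne_zero hR₀ (heunWeight_ne_zero hsub s ω m hr₀)

/-- Conversely, a non-trivial solution `y` of the connection problem at an angular eigenvalue `λ`
gives the mode solution `R = w · (y ∘ z)`. [cite: Hatsuda2020, §3.1 (3.2)–(3.5)] -/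
theorem isModeSolution_of_hasHeunConnectionSolution {M a Λ : ℝ} (hsub : IsSubextremal M a Λ)
    {s : ℝ} {ω : ℂ} {m : ℝ} {lam : ℂ} (hang : IsAngularEigenvalue a Λ s ω m lam)
    (hy : HasHeunConnectionSolution M a Λ s ω m lam) :
    ∃ R : ℝ → ℂ, IsModeSolution M a Λ s ω m lam R := by
  obtain ⟨y, hsol, h0, h1, x₀, hx₀, hy₀⟩ := hy
  refine ⟨fun r => heunWeight M a Λ s ω m r * y (mobiusZ M a Λ r), hang,
    isRadialTeukolskySolution_of_heunSolution hsub hsol,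
    isIngoingAtEventHorizon_of_heun_branch_at_zero hsub s ω m h0,
    isOutgoingAtCosmoHorizon_of_heun_smooth_at_one hsub s ω m h1,
    mobiusInv M a Λ x₀, mobiusInv_mem_Ioo hsub hx₀, ?_⟩
  have hxinf : x₀ ≠ mobiusZinf M a Λ := ne_of_lt (hx₀.2.trans (one_lt_mobiusZinf hsub))
  beta_reduce
  rw [mobiusZ_mobiusInv hsub hxinf]
  exact mul_ne_zero (heunWeight_ne_zero hsub s ω m (mobiusInv_mem_Ioo hsub hx₀)) hy₀

/-- **`(ω, m)` carries a mode iff, for some angular eigenvalue `λ`, Hatsuda's connection problem for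
the radial Heun equation has a non-trivial solution** — the quasinormal-mode condition in Heun form
("The QNM boundary condition then requires `C₂₂ = 0`"), as an equivalence of `Prop`s with the
tree's `HasMode`. [cite: Hatsuda2020, §3.1 (3.2)–(3.5)] -/
theorem hasMode_iff_heunConnection {M a Λ : ℝ} (hsub : IsSubextremal M a Λ) (s : ℝ) (ω : ℂ) (m : ℝ) :
    HasMode M a Λ s ω m ↔
      ∃ lam : ℂ, IsAngularEigenvalue a Λ s ω m lam ∧ HasHeunConnectionSolution M a Λ s ω m lam := by
  constructor
  · rintro ⟨lam, R, hR⟩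
    exact ⟨lam, hR.1, hasHeunConnectionSolution_of_isModeSolution hsub hR⟩
  · rintro ⟨lam, hang, hy⟩
    obtain ⟨R, hR⟩ := isModeSolution_of_hasHeunConnectionSolution hsub hang hy
    exact ⟨lam, R, hR⟩

/-- Hence "no mode in the window `W`" is the statement that the connection problem has no non-trivial
solution for `(ω, m) ∈ W` (admissible `m`) and any angular eigenvalue `λ` — the shape certified by a
Heun-function (continued-fraction / Wronskian `C₂₂ ≠ 0`) computation. [cite: Hatsuda2020, §3.1 (3.5)] -/
theorem noModeIn_iff_heunConnection {M a Λ : ℝ} (hsub : IsSubextremal M a Λ) (s : ℝ) (W : Set (ℂ × ℝ)) :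
    NoModeIn M a Λ s W ↔ ∀ ω : ℂ, ∀ m : ℝ, (ω, m) ∈ W → (∃ k : ℤ, m - s = k) →
      ∀ lam : ℂ, IsAngularEigenvalue a Λ s ω m lam → ¬HasHeunConnectionSolution M a Λ s ω m lam := by
  refine forall₂_congr fun ω m => forall₂_congr fun hW hm => ?_
  rw [hasMode_iff_heunConnection hsub]
  simp only [not_exists, not_and]

end Literature.Geometry.Lorentzian.KerrDeSitter

end
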